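import Literature.NumberTheory.EllipticCurves.SupersingularModPDecompositionImage
import Literature.NumberTheory.EllipticCurves.SerreOpenImageSupersingularInertiaProofs
import Literature.NumberTheory.EllipticCurves.SerreOpenImageSupersingularAssemblyProofs
import Literature.NumberTheory.EllipticCurves.SerreOpenImageTameKummerProofs
import Literature.NumberTheory.EllipticCurves.SerreOpenImageOrdinaryInertiaProofs
import Literature.NumberTheory.EllipticCurves.FrobeniusScalarCharTwoProofs
import Literature.NumberTheory.EllipticCurves.GlobalMinimalModelProofs
import Literature.NumberTheory.EllipticCurves.VariableChangePointsMap
import Literature.NumberTheory.EllipticCurves.LFunctionSmulProofs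
import Literature.NumberTheory.EllipticCurves.LFunctionPrimeCoeff
import Literature.NumberTheory.DiophantineGeometry.LocalReductionProofs
import Literature.NumberTheory.Automorphic.BCDTModularityModPProofs
import Literature.NumberTheory.GaloisRepresentations.SerreInertiaImageGL2Fp
import Literature.NumberTheory.GaloisRepresentations.SerreCartanNormalizerGL2Fp
import Literature.NumberTheory.GaloisRepresentations.SerreCartanSubgroupsGL2FpProofs
import Literature.NumberTheory.GaloisRepresentations.IntegralGaloisActionProofs
import HarnessLib

/-!
# Serre 1972, §1.11 Prop. 12 (c), (d) over `ℚ`: the images of inertia and of the decomposition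
# group on `E[p]` at a good supersingular prime — discharge of
# `serre1972_supersingular_decompositionSubgroup_image`

`Proofs` file (theorems only: no definition, no named fact, no instance), topic
`NumberTheory/EllipticCurves`; companion of `SupersingularModPDecompositionImage.lean` (the named
fact) and sequel of `SerreOpenImageSupersingular{Valuation,Parameter,Inertia,Assembly}Proofs`,
`SerreOpenImageTameKummerProofs` (Prop. 12 (c) at an ODD prime for a minimal model at the place's
prime, and the surjectivity of the tame Kummer character) and of
`GaloisRepresentations/SerreInertiaImageGL2Fp`, `SerreCartanNormalizerGL2Fp` (§2.1 b): a cyclic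
subgroup of `GL₂(𝔽_p)` of order `p² - 1` is a non-split Cartan subgroup `C`; §2.2:
`(N(C) : C) = 2`).

J.-P. Serre, *Propriétés galoisiennes des points d'ordre fini des courbes elliptiques*, Invent.
Math. 15 (1972), §1.11 Prop. 12 (`e = 1`, good reduction of height `2`): *(c) L'image de `I` dans
`GL(E_p)` est un groupe cyclique `C` d'ordre `p² - 1`; (d) l'image de `G` dans `GL(E_p)` est égale
à `C` ou au normalisateur `N` de `C` suivant que `k` contient ou ne contient pas `𝔽_{p²}`* — over
`ℚ_p` the residue field is `𝔽_p ⊉ 𝔽_{p²}`, so the image of the decomposition group is `N`, of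
order `2(p² - 1)` (§2.2).  Main results:

* `valuation_X_of_two_torsion` — **`p = 2`**: at a good supersingular `2` of a minimal `W/ℚ`
  (`2 ∤ Δ`, `2 ∣ a₂`, whence `2 ∣ a₁`, `2 ∤ a₃` on the minimal model:
  `two_dvd_a₁_integralModelInt_of_dvd_frobeniusTrace`) every nonzero `P = (x, y) ∈ E[2]` has
  `v(x) > 1` and `v(4)·v(x)³ = 1` at the place `placeOver 2` of `ℚ̄` (`Ψ₂² = 4x³ + b₂x² + 2b₄x + b₆`
  with `4 ∣ b₂`, `4 ∣ 2b₄`, `b₆` odd).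
* `exists_smul_ne_of_smul_eq_mul` — every prime `p`: an inertia element `s` with `s π = ξ π`,
  `ξ ≠ 1` (`π^{p²-1} = p`) moves some point of `E[p]` (the tame character is injective on `ρ̄(I)`).
* `isCyclic_and_card_inertia_map_of_dvd_frobeniusTrace_two` / `…_all` — **Prop. 12 (c) at the
  place's prime for EVERY prime `p`** (the case `p = 2` is new: `ρ̄(I) ≅ ψ(I) = μ₃` for the Kummer
  cocycle `ψ(s) = s(π)/π`, the three nonzero points of `E[2]` being separated by the residues of the
  units `π² x(P)`).
* `exists_mem_decompositionSubgroup_forall_exists_smul_ne` — **the Frobenius escape**: an arithmetic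
  Frobenius `φ` at `𝔓` does not act on `E[p]` as any element of `I_𝔓` (`φ ζ = ζ^p ≠ ζ` for a
  primitive `(p² - 1)`-th root of unity `ζ`).
* `card_eq_two_mul_of_isCyclic_of_le_normalizer` — §2.1 b) + §2.2 in `GL₂(𝔽_p)`: `C ≤ N ≤ N(C)`,
  `N ≠ C`, `C` cyclic of order `p² - 1` force `#N = 2(p² - 1)`.
* `serre1972_supersingular_decompositionSubgroup_image_holds` — **the discharge**, for every model
  `W/ℚ`, every framing `ρ̄` of `E[p]` and every prime `𝔓` above `v` (transports: global minimal
  model `hasGlobalMinimalModel_rat_holds`, `isTorsionGaloisRep_variableChange`,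
  `frobeniusTraceAt_variableChange`, conjugate primes `exists_smul_eq_of_mem_primesAbove_holds`,
  equality of kernels of `ρ̄` and of the intrinsic `galoisRepTorsion`).

## References

* [SerreInventiones1972] J.-P. Serre, Invent. Math. 15 (1972) 259–331: §1.3 (Prop. 1–2), §1.11
  Prop. 12 (c), (d); §2.1 b); §2.2.
* [SilvermanAEC2009] J. H. Silverman, *The Arithmetic of Elliptic Curves*, 2nd ed. (2009): III.§7,
  VII.1 Prop. 1.3(b), Appendix A Prop. 1.1(c), Exercise 5.7, C.§16.

## Design

`noncomputable section`; nothing is defined; helper statements that exist elsewhere in the tree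
under heavier imports (`isTorsionGaloisRep_smul`, `frobeniusTraceAt_smul`,
`conj_mem_inertia_of_smul_eq`, `primesEquiv_eq_of_natCast_mem`, `Rat.residueCard_eq_natGenerator`)
are re-proved here under primed / new names to keep the import cone inside the `SerreOpenImage*`
files.
-/

noncomputable section

open scoped Classical NumberField MatrixGroups Pointwise
open IsDedekindDomain Field Polynomial NumberField

namespace Literature.NumberTheory.EllipticCurves

open _root_.WeierstrassCurve Literature.NumberTheory.GaloisRepresentations Rat.HeightOneSpectrum

/-! ## §1 Two torsion at a good supersingular `2`: the abscissa has valuation `-2/3` -/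

section TwoTorsion

variable {W : WeierstrassCurve ℚ} [W.IsGloballyMinimal]

/-- At a good prime `2` with `2 ∣ a₂(W)` (supersingular reduction) the minimal model has
`2 ∣ a₁`: otherwise the reduction `Ẽ/𝔽₂` (an elliptic curve, `2 ∤ Δ`) has the point
`(a₃/a₁, √·)` of order `2` over `𝔽̄₂` (`exists_two_nsmul_eq_zero_of_a₁_ne_zero`), while a curve over
`𝔽₂` with even trace has no point of order `2` (`forall_nsmul_ne_zero_of_dvd_trace`).  In
characteristic `2` the Hasse invariant is `a₁` (Silverman, *AEC*, App. A Prop. 1.1 (c), Ex. 5.7).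
[cite: SilvermanAEC2009, Appendix A Prop. 1.1(c) and Exercise 5.7] -/
theorem two_dvd_a₁_integralModelInt_of_dvd_frobeniusTrace (ℓ : ℕ) [Fact ℓ.Prime] (hℓ2 : ℓ = 2)
    (hΔ : ¬ (ℓ : ℤ) ∣ minimalDiscriminantInt W) (hss : (ℓ : ℤ) ∣ W.frobeniusTrace ℓ) :
    (2 : ℤ) ∣ (integralModelInt W).a₁ := by
  subst hℓ2
  haveI : (reductionModPrime W 2).IsElliptic := isElliptic_reductionModPrime W hΔ
  by_contra h
  have ha₁ : (reductionModPrime W 2).a₁ ≠ 0 := by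
    rw [reductionModPrime, map_a₁, eq_intCast, Ne, ZMod.intCast_zmod_eq_zero_iff_dvd]
    exact_mod_cast h
  have h2 : (2 : ZMod 2) = 0 := by exact_mod_cast ZMod.natCast_self 2
  obtain ⟨T, hT0, hT2⟩ := (reductionModPrime W 2).exists_two_nsmul_eq_zero_of_a₁_ne_zero h2 ha₁
  obtain ⟨σ, hσ⟩ := WeierstrassCurve.exists_frobenius_absoluteGaloisGroup (ZMod 2)
  have ha : ((2 : ℕ) : ℤ) ∣ (Nat.card (ZMod 2) : ℤ) + 1 -
      Nat.card (reductionModPrime W 2).toAffine.Point := by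
    rw [Nat.card_zmod, ← frobeniusTrace_eq_sub_natCard_reductionModPrime]
    exact hss
  exact (reductionModPrime W 2).forall_nsmul_ne_zero_of_dvd_trace 2 hσ ha T hT0 hT2

/-- … and `2 ∤ a₃` (`Δ ≡ a₃⁴ (mod 2)` when `2 ∣ a₁`, and `2 ∤ Δ`; Silverman, *AEC*, App. A
Prop. 1.1 (c): `a₃_ne_zero_of_a₁_eq_zero_of_two_eq_zero` for the reduction `Ẽ/𝔽₂`).
[cite: SilvermanAEC2009, Appendix A Prop. 1.1(c)] -/
theorem not_two_dvd_a₃_integralModelInt_of_dvd_frobeniusTrace [W.IsElliptic] (ℓ : ℕ) [Fact ℓ.Prime]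
    (hℓ2 : ℓ = 2) (hΔ : ¬ (ℓ : ℤ) ∣ minimalDiscriminantInt W)
    (hss : (ℓ : ℤ) ∣ W.frobeniusTrace ℓ) : ¬ (2 : ℤ) ∣ (integralModelInt W).a₃ := by
  have h1 := two_dvd_a₁_integralModelInt_of_dvd_frobeniusTrace ℓ hℓ2 hΔ hss
  subst hℓ2
  haveI : (reductionModPrime W 2).IsElliptic := isElliptic_reductionModPrime W hΔ
  have ha₁ : (reductionModPrime W 2).a₁ = 0 := by
    rw [reductionModPrime, map_a₁, eq_intCast, ZMod.intCast_zmod_eq_zero_iff_dvd]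
    exact_mod_cast h1
  have h2 : (2 : ZMod 2) = 0 := by exact_mod_cast ZMod.natCast_self 2
  have ha₃ := (reductionModPrime W 2).a₃_ne_zero_of_a₁_eq_zero_of_two_eq_zero h2 ha₁
  intro h3
  apply ha₃
  rw [reductionModPrime, map_a₃, eq_intCast, ZMod.intCast_zmod_eq_zero_iff_dvd]
  exact_mod_cast h3

/-- The base change of a globally minimal `W/ℚ` to `ℚ̄` is the integer model read in `ℚ̄`.
[folklore] -/
private theorem baseChange_algebraicClosure_eq_map_integralModelInt :
    W.baseChange (AlgebraicClosure ℚ) =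
      (integralModelInt W).map (Int.castRingHom (AlgebraicClosure ℚ)) := by
  conv_lhs => rw [← map_integralModelInt W]
  rw [baseChange, WeierstrassCurve.map_map]
  exact congrArg (integralModelInt W).map (RingHom.ext_int _ _)

/-- **The abscissa of a point of order `2` at a good supersingular `2`: `v(x) > 1` and
`v(4)·v(x)³ = 1`** (multiplicative valuation of the place `placeOver 2` of `ℚ̄`; i.e.
`ord₂(x) = -2/3`).  The point satisfies `Ψ₂²(x) = 4x³ + b₂x² + 2b₄x + b₆ = 0` with `4 ∣ b₂`,
`4 ∣ 2b₄` (`2 ∣ a₁`) and `b₆` odd (`2 ∤ a₃`), and `x` is not `2`-integral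
(`one_lt_valuation_of_zsmul_eq_zero`: the `2`-torsion reduces to `Õ`), so `4x³` dominates the two
middle terms and must cancel `b₆`.  Serre 1972, §1.11 (points of order `p` of a height-`2` formal
group over an absolutely unramified base lie at level `1/(p² - 1)`), case `p = 2`.
[cite: SerreInventiones1972, §1.11 Prop. 12] -/
theorem valuation_X_of_two_torsion [W.IsElliptic] (ℓ : ℕ) [Fact ℓ.Prime] (hℓ2 : ℓ = 2)
    (hΔ : ¬ (ℓ : ℤ) ∣ minimalDiscriminantInt W) (hss : (ℓ : ℤ) ∣ W.frobeniusTrace ℓ)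
    {P : W.geomPoints} (hP : (ℓ : ℤ) • P = 0) {x y : AlgebraicClosure ℚ} {h}
    (hPxy : P = .some x y h) :
    1 < (placeOver ℓ).valuation x ∧
      (placeOver ℓ).valuation (4 : AlgebraicClosure ℚ) * (placeOver ℓ).valuation x ^ 3 = 1 := by
  have ha₁ := two_dvd_a₁_integralModelInt_of_dvd_frobeniusTrace ℓ hℓ2 hΔ hss
  have ha₃ := not_two_dvd_a₃_integralModelInt_of_dvd_frobeniusTrace ℓ hℓ2 hΔ hss
  have hx1 : 1 < (placeOver ℓ).valuation x := one_lt_valuation_of_zsmul_eq_zero ℓ hΔ hss hP hPxy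
  subst hℓ2
  set v := (placeOver 2).valuation with hv
  refine ⟨hx1, ?_⟩
  -- the `2`-division relation `4x³ + b₂x² + 2b₄x + b₆ = 0`
  set V := W.baseChange (AlgebraicClosure ℚ) with hV
  have hP' : (2 : ℤ) • (Affine.Point.some x y h : V.toAffine.Point) = 0 := by
    have : ((2 : ℕ) : ℤ) • P = 0 := hP
    rwa [hPxy] at this
  have hΨ : (V.ΨSq 2).eval x = 0 := (V.zsmul_some_eq_zero_iff_eval_ΨSq h 2).mp hP'
  rw [V.ΨSq_two] at hΨ
  have hfdef : V.Ψ₂Sq = C 4 * X ^ 3 + C V.b₂ * X ^ 2 + C (2 * V.b₄) * X + C V.b₆ := rfl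
  rw [hfdef] at hΨ
  simp only [eval_add, eval_mul, eval_C, eval_pow, eval_X] at hΨ
  -- the `b`-coefficients are the integers of the minimal model
  have e := baseChange_algebraicClosure_eq_map_integralModelInt (W := W)
  set M := integralModelInt W with hM
  have hb₂ : V.b₂ = ((M.b₂ : ℤ) : AlgebraicClosure ℚ) := by
    rw [hV, congrArg WeierstrassCurve.b₂ e, map_b₂, eq_intCast]
  have hb₄ : V.b₄ = ((M.b₄ : ℤ) : AlgebraicClosure ℚ) := by
    rw [hV, congrArg WeierstrassCurve.b₄ e, map_b₄, eq_intCast]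
  have hb₆ : V.b₆ = ((M.b₆ : ℤ) : AlgebraicClosure ℚ) := by
    rw [hV, congrArg WeierstrassCurve.b₆ e, map_b₆, eq_intCast]
  -- integer divisibilities
  obtain ⟨c, hc⟩ := ha₁
  have hb₂d : ∃ c₂ : ℤ, M.b₂ = 4 * c₂ := ⟨c ^ 2 + M.a₂, by rw [WeierstrassCurve.b₂, hc]; ring⟩
  have hb₄d : ∃ c₄ : ℤ, 2 * M.b₄ = 4 * c₄ :=
    ⟨M.a₄ + c * M.a₃, by rw [WeierstrassCurve.b₄, hc]; ring⟩
  have hb₆d : ¬ (2 : ℤ) ∣ M.b₆ := by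
    intro hd
    apply ha₃
    have h6 : (2 : ℤ) ∣ M.a₃ ^ 2 := by
      have : M.a₃ ^ 2 = M.b₆ - 2 * (2 * M.a₆) := by rw [WeierstrassCurve.b₆]; ring
      rw [this]
      exact dvd_sub hd (dvd_mul_right 2 _)
    exact Int.Prime.dvd_pow' Nat.prime_two h6
  obtain ⟨c₂, hc₂⟩ := hb₂d
  obtain ⟨c₄, hc₄⟩ := hb₄d
  -- valuations of the coefficients
  have hint : ∀ n : ℤ, v (n : AlgebraicClosure ℚ) ≤ 1 := fun n ↦
    ((placeOver 2).valuation_le_one_iff _).mpr (intCast_mem _ n)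
  have h4 : v (4 : AlgebraicClosure ℚ) < 1 := by
    have := (valuation_placeOver_intCast_lt_one_iff 2 (n := 4)).mpr ⟨2, by norm_num⟩
    exact_mod_cast this
  have h40 : v (4 : AlgebraicClosure ℚ) ≠ 0 :=
    (Valuation.ne_zero_iff v).mpr (by norm_num)
  have hvb₂ : v V.b₂ ≤ v (4 : AlgebraicClosure ℚ) := by
    rw [hb₂, hc₂, Int.cast_mul, map_mul]
    calc v ((4 : ℤ) : AlgebraicClosure ℚ) * v (c₂ : AlgebraicClosure ℚ)
        ≤ v ((4 : ℤ) : AlgebraicClosure ℚ) * 1 := mul_le_mul' le_rfl (hint c₂)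
      _ = v (4 : AlgebraicClosure ℚ) := by rw [mul_one]; norm_num
  have hvb₄ : v (2 * V.b₄) ≤ v (4 : AlgebraicClosure ℚ) := by
    rw [hb₄, show (2 : AlgebraicClosure ℚ) * ((M.b₄ : ℤ) : AlgebraicClosure ℚ) =
      ((2 * M.b₄ : ℤ) : AlgebraicClosure ℚ) by push_cast; ring, hc₄, Int.cast_mul, map_mul]
    calc v ((4 : ℤ) : AlgebraicClosure ℚ) * v (c₄ : AlgebraicClosure ℚ)
        ≤ v ((4 : ℤ) : AlgebraicClosure ℚ) * 1 := mul_le_mul' le_rfl (hint c₄)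
      _ = v (4 : AlgebraicClosure ℚ) := by rw [mul_one]; norm_num
  have hvb₆ : v V.b₆ = 1 := by
    rw [hb₆]
    exact valuation_placeOver_intCast_eq_one 2 (by exact_mod_cast hb₆d)
  -- domination: `v (4x³) > v (b₂x²), v (2b₄x)`
  have hx0 : v x ≠ 0 := by rintro h0; rw [h0] at hx1; exact not_lt_zero hx1
  have hlead : v (4 * x ^ 3) = v (4 : AlgebraicClosure ℚ) * v x ^ 3 := by rw [map_mul, map_pow]
  have hx2 : v x ^ 2 < v x ^ 3 := by
    calc v x ^ 2 = v x ^ 2 * 1 := (mul_one _).symm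
      _ < v x ^ 2 * v x := mul_lt_mul_left_of_ne_zero (pow_ne_zero 2 hx0) hx1
      _ = v x ^ 3 := (pow_succ (v x) 2).symm
  have hmid₁ : v (V.b₂ * x ^ 2) < v (4 * x ^ 3) := by
    rw [map_mul, map_pow, hlead]
    calc v V.b₂ * v x ^ 2 ≤ v (4 : AlgebraicClosure ℚ) * v x ^ 2 := mul_le_mul' hvb₂ le_rfl
      _ < v (4 : AlgebraicClosure ℚ) * v x ^ 3 := mul_lt_mul_left_of_ne_zero h40 hx2
  have hx13 : v x < v x ^ 3 := by
    calc v x = v x * 1 := (mul_one _).symm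
      _ < v x * v x ^ 2 := by
          refine mul_lt_mul_left_of_ne_zero hx0 ?_
          exact one_lt_pow_succ_of_one_lt hx1 1
      _ = v x ^ 3 := (pow_succ' (v x) 2).symm
  have hmid₂ : v (2 * V.b₄ * x) < v (4 * x ^ 3) := by
    rw [map_mul, hlead]
    calc v (2 * V.b₄) * v x ≤ v (4 : AlgebraicClosure ℚ) * v x := mul_le_mul' hvb₄ le_rfl
      _ < v (4 : AlgebraicClosure ℚ) * v x ^ 3 := mul_lt_mul_left_of_ne_zero h40 hx13
  have hS : v (4 * x ^ 3 + V.b₂ * x ^ 2 + 2 * V.b₄ * x) = v (4 * x ^ 3) := by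
    have h1 : v (4 * x ^ 3 + V.b₂ * x ^ 2) = v (4 * x ^ 3) :=
      Valuation.map_add_eq_of_lt_left _ hmid₁
    rw [Valuation.map_add_eq_of_lt_left _ (by rw [h1]; exact hmid₂), h1]
  have hsum : 4 * x ^ 3 + V.b₂ * x ^ 2 + 2 * V.b₄ * x = -V.b₆ := by
    linear_combination hΨ
  rw [hsum, Valuation.map_neg, hvb₆] at hS
  rw [← hlead, ← hS]

end TwoTorsion

/-! ## §2 Inertia and roots of unity; the tame Kummer cocycle `s ↦ s(π)/π` -/

section Kummer

variable (ℓ : ℕ) [Fact ℓ.Prime]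

/-- **Inertia fixes the roots of unity of order prime to `ℓ`** (Serre 1972, §1.3: `μ_d` injects
into the residue field for `ℓ ∤ d`): for `s ∈ I_𝔓` and `ξ ∈ ℚ̄` with `ξⁿ = 1`, `ℓ ∤ n`, one has
`s ξ = ξ` — `s ξ / ξ` is an `n`-th root of unity `≡ 1 (mod 𝔓)`.
[cite: SerreInventiones1972, §1.3] -/
theorem smul_eq_self_of_pow_eq_one_of_mem_inertia' {𝔓 : Ideal (absIntegers (𝓞 ℚ) ℚ)}
    (hmem : ∀ x : absIntegers (𝓞 ℚ) ℚ, x ∈ 𝔓 ↔ (x : AlgebraicClosure ℚ) ∈ (placeOver ℓ).nonunits)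
    {s : absoluteGaloisGroup ℚ} (hs : s ∈ 𝔓.inertia (absoluteGaloisGroup ℚ)) {n : ℕ}
    (hn : ¬ (ℓ : ℤ) ∣ (n : ℤ)) {ξ : AlgebraicClosure ℚ} (hξ : ξ ^ n = 1) : s • ξ = ξ := by
  set v := (placeOver ℓ).valuation with hv
  have hn0 : n ≠ 0 := by rintro rfl; exact hn (by simp)
  have hξ0 : ξ ≠ 0 := fun h ↦ by rw [h, zero_pow hn0] at hξ; exact zero_ne_one hξ
  have hvξ : v ξ = 1 :=
    pow_left_injective_of_ne_zero hn0 (by rw [← map_pow, hξ, map_one, one_pow])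
  have hξmem : ξ ∈ placeOver ℓ := (ValuationSubring.valuation_le_one_iff _ _).mp hvξ.le
  have hlt := valuation_smul_sub_lt_one_of_mem_inertia hmem hs hξmem
  set η := s • ξ / ξ with hη
  have hηn : η ^ n = 1 := by
    rw [hη, div_pow, ← smul_pow', hξ, smul_one, div_one]
  have hη1 : v (η - 1) < 1 := by
    have : η - 1 = (s • ξ - ξ) / ξ := by rw [hη, sub_div, div_self hξ0]
    rw [this, map_div₀, hvξ, div_one]
    exact hlt
  have := eq_one_of_pow_eq_one_of_valuation_sub_one_lt ℓ hn hηn hη1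
  rw [hη, div_eq_one_iff_eq hξ0] at this
  exact this

/-- `ℓ ∤ ℓ² - 1`. [folklore] -/
private theorem not_dvd_sq_sub_one : ¬ (ℓ : ℤ) ∣ ((ℓ ^ 2 - 1 : ℕ) : ℤ) := by
  have hp : ℓ.Prime := Fact.out
  intro h
  have h1 : (ℓ : ℤ) ∣ ((ℓ ^ 2 : ℕ) : ℤ) := by push_cast; exact dvd_pow_self _ two_ne_zero
  have h2 : (ℓ : ℤ) ∣ ((ℓ ^ 2 : ℕ) : ℤ) - ((ℓ ^ 2 - 1 : ℕ) : ℤ) := dvd_sub h1 h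
  have h4 : 1 ≤ ℓ ^ 2 := Nat.one_le_pow _ _ hp.pos
  have h3 : ((ℓ ^ 2 : ℕ) : ℤ) - ((ℓ ^ 2 - 1 : ℕ) : ℤ) = 1 := by
    rw [Nat.cast_sub h4]; push_cast; ring
  rw [h3] at h2
  exact hp.one_lt.ne' (by exact_mod_cast Int.eq_one_of_dvd_one (by positivity) h2)

/-- The Kummer cocycle: for `πⁿ = ℓ` and any `s ∈ Γ_ℚ`, `s π = ξ π` with `ξⁿ = 1` (`(sπ)ⁿ = ℓ`).
[cite: SerreInventiones1972, §1.3] -/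
theorem exists_smul_eq_mul_of_pow_eq {n : ℕ} (hn : 0 < n) {π : AlgebraicClosure ℚ}
    (hπ : π ^ n = ℓ) (s : absoluteGaloisGroup ℚ) :
    ∃ ξ : AlgebraicClosure ℚ, ξ ^ n = 1 ∧ s • π = ξ * π := by
  have hp : ℓ.Prime := Fact.out
  have hπ0 : π ≠ 0 := by
    rintro rfl
    rw [zero_pow hn.ne'] at hπ
    exact (Nat.cast_ne_zero.mpr hp.ne_zero) hπ.symm
  refine ⟨s • π / π, ?_, by rw [div_mul_cancel₀ _ hπ0]⟩
  rw [div_pow, ← smul_pow', hπ, div_eq_one_iff_eq (by rw [← hπ] at *; exact pow_ne_zero _ hπ0)]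
  rw [absoluteGaloisGroup.smul_def, map_natCast]

/-- If `s π = ξ π` (`πⁿ = ℓ`) then `ξⁿ = 1`. [folklore] -/
private theorem pow_eq_one_of_smul_eq_mul {n : ℕ} (hn : 0 < n) {π ξ : AlgebraicClosure ℚ}
    (hπ : π ^ n = ℓ) {s : absoluteGaloisGroup ℚ} (hs : s • π = ξ * π) : ξ ^ n = 1 := by
  have hp : ℓ.Prime := Fact.out
  have hπ0 : π ≠ 0 := by
    rintro rfl
    rw [zero_pow hn.ne'] at hπ
    exact (Nat.cast_ne_zero.mpr hp.ne_zero) hπ.symm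
  have h1 : (s • π) ^ n = ℓ := by rw [← smul_pow', hπ, absoluteGaloisGroup.smul_def, map_natCast]
  rw [hs, mul_pow, hπ] at h1
  have hℓ0 : ((ℓ : ℕ) : AlgebraicClosure ℚ) ≠ 0 := Nat.cast_ne_zero.mpr hp.ne_zero
  calc ξ ^ n = ξ ^ n * (ℓ : AlgebraicClosure ℚ) / ℓ := by rw [mul_div_cancel_right₀ _ hℓ0]
    _ = 1 := by rw [h1, div_self hℓ0]

end Kummer

/-! ## §3 An inertia element moving `π` (`π^{ℓ²-1} = ℓ`) acts non-trivially on `E[ℓ]` -/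

section Nontrivial

variable (ℓ : ℕ) [Fact ℓ.Prime] {W : WeierstrassCurve ℚ} [W.IsGloballyMinimal] [W.IsElliptic]

omit [W.IsGloballyMinimal] in
/-- `E[ℓ]` has a non-zero point, with affine coordinates. [folklore] -/
private theorem exists_ne_zero_geomTorsion :
    ∃ (P : geomTorsion W ℓ) (x y : AlgebraicClosure ℚ) (h : _),
      (P : W.geomPoints) = .some x y h := by
  have hp : ℓ.Prime := Fact.out
  have hℓ' : (ℓ : AlgebraicClosure ℚ) ≠ 0 := Nat.cast_ne_zero.mpr hp.ne_zero
  have hcard : Nat.card (geomTorsion W ℓ) = ℓ ^ 2 :=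
    card_torsionPoints_eq_sq_holds W (AlgebraicClosure ℚ) (n := ℓ) hℓ'
  haveI : Finite (geomTorsion W ℓ) :=
    Nat.finite_of_card_ne_zero (by rw [hcard]; exact pow_ne_zero _ hp.ne_zero)
  haveI : Nontrivial (geomTorsion W ℓ) := Finite.one_lt_card_iff_nontrivial.mp (by
    rw [hcard]; nlinarith [hp.two_le])
  obtain ⟨P₀, hP₀0⟩ := exists_ne (0 : geomTorsion W ℓ)
  have hP₀0' : (P₀ : W.geomPoints) ≠ 0 := fun h ↦ hP₀0 (Subtype.ext h)
  obtain ⟨x₀, y₀, h₀, hP₀xy⟩ := geomPoints.exists_eq_some (P := (P₀ : W.geomPoints)) hP₀0'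
  exact ⟨P₀, x₀, y₀, h₀, hP₀xy⟩

/-- **`ℓ = 2`: at a good supersingular `2`, for `π³ = 2` and a nonzero `P = (x, y) ∈ E[2]`,
`ε = π² x` is a `𝔓`-unit** (`v(4) v(x)³ = 1`, `valuation_X_of_two_torsion`).
[cite: SerreInventiones1972, §1.11 Prop. 12] -/
theorem valuation_sq_mul_X_eq_one (hℓ2 : ℓ = 2) (hΔ : ¬ (ℓ : ℤ) ∣ minimalDiscriminantInt W)
    (hss : (ℓ : ℤ) ∣ W.frobeniusTrace ℓ) {π : AlgebraicClosure ℚ} (hπ : π ^ (ℓ ^ 2 - 1) = ℓ)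
    {P : W.geomPoints} (hP : (ℓ : ℤ) • P = 0) {x y : AlgebraicClosure ℚ} {h}
    (hPxy : P = .some x y h) : (placeOver ℓ).valuation (π ^ 2 * x) = 1 := by
  obtain ⟨-, hx⟩ := valuation_X_of_two_torsion ℓ hℓ2 hΔ hss hP hPxy
  subst hℓ2
  set v := (placeOver 2).valuation with hv
  have hπ3 : π ^ 3 = 2 := by simpa using hπ
  have h4 : v (4 : AlgebraicClosure ℚ) = v π ^ 6 := by
    rw [show (4 : AlgebraicClosure ℚ) = 2 ^ 2 by norm_num, ← hπ3, ← pow_mul, map_pow]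
  apply pow_left_injective_of_ne_zero (n := 3) three_ne_zero
  rw [one_pow, map_mul, map_pow, mul_pow, ← pow_mul, show 2 * 3 = 6 by rfl, ← h4, hx]

/-- **An inertia element that moves `π` moves `E[ℓ]`, `ℓ = 2`.**  Let `2` be a good supersingular
prime of the minimal `W/ℚ`, `π³ = 2`, `s ∈ I_𝔓` with `s π = ξ π`.  If `s` fixes `E[2]` pointwise
then `ξ = 1`: with `P₀ = (x₀, y₀) ∈ E[2] ∖ 0` and the unit `ε = π² x₀`, `s ε = ξ² ε ≡ ε`, so
`ξ² ≡ 1`, `ξ² = 1`, `ξ = ξ³ = 1`. [cite: SerreInventiones1972, §1.11 Prop. 12] -/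
theorem eq_one_of_forall_smul_eq_two (hℓ2 : ℓ = 2) (hΔ : ¬ (ℓ : ℤ) ∣ minimalDiscriminantInt W)
    (hss : (ℓ : ℤ) ∣ W.frobeniusTrace ℓ) {𝔓 : Ideal (absIntegers (𝓞 ℚ) ℚ)}
    (hmem : ∀ x : absIntegers (𝓞 ℚ) ℚ, x ∈ 𝔓 ↔ (x : AlgebraicClosure ℚ) ∈ (placeOver ℓ).nonunits)
    {s : absoluteGaloisGroup ℚ} (hs : s ∈ 𝔓.inertia (absoluteGaloisGroup ℚ))
    {π ξ : AlgebraicClosure ℚ} (hπ : π ^ (ℓ ^ 2 - 1) = ℓ) (hsπ : s • π = ξ * π)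
    (hfix : ∀ P : geomTorsion W ℓ, s • P = P) : ξ = 1 := by
  set v := (placeOver ℓ).valuation with hv
  have hn : 0 < ℓ ^ 2 - 1 := by rw [hℓ2]; norm_num
  have hξn := pow_eq_one_of_smul_eq_mul ℓ hn hπ hsπ
  rw [hℓ2, show 2 ^ 2 - 1 = 3 by rfl] at hξn
  obtain ⟨P₀, x₀, y₀, h₀, hP₀xy⟩ := exists_ne_zero_geomTorsion ℓ (W := W)
  have hP₀t : (ℓ : ℤ) • (P₀ : W.geomPoints) = 0 := (Submodule.mem_torsionBy_iff _ _).mp P₀.2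
  have hε := valuation_sq_mul_X_eq_one ℓ hℓ2 hΔ hss hπ hP₀t hP₀xy
  set ε := π ^ 2 * x₀ with hεdef
  have hεmem : ε ∈ placeOver ℓ := (ValuationSubring.valuation_le_one_iff _ _).mp hε.le
  -- `s x₀ = x₀`
  have hsx₀ : s • x₀ = x₀ := by
    have h1 : ((s • P₀ : geomTorsion W ℓ) : W.geomPoints) = (P₀ : W.geomPoints) := by rw [hfix P₀]
    obtain ⟨h', hs'⟩ := exists_smul_eq_some (W := W) s hP₀xy
    have h2 : ((s • P₀ : geomTorsion W ℓ) : W.geomPoints) = s • (P₀ : W.geomPoints) := rfl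
    rw [h2, hs', hP₀xy] at h1
    exact ((Affine.Point.some.injEq _ _ _ _ _ _).mp h1).1
  -- `s ε = ξ² ε`
  have hsε : s • ε = ξ ^ 2 * ε := by
    rw [hεdef, smul_mul', smul_pow', hsπ, hsx₀]; ring
  have hlt := valuation_smul_sub_lt_one_of_mem_inertia hmem hs hεmem
  rw [hsε, ← sub_one_mul, map_mul, hε, mul_one] at hlt
  have h2 : ξ ^ 2 = 1 := by
    refine eq_one_of_pow_eq_one_of_valuation_sub_one_lt ℓ (n := 3) ?_ ?_ hlt
    · rw [hℓ2]; decide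
    · rw [← pow_mul, mul_comm, pow_mul, hξn, one_pow]
  calc ξ = ξ * ξ ^ 2 := by rw [h2, mul_one]
    _ = ξ ^ 3 := by ring
    _ = 1 := hξn

/-- **An inertia element that moves `π` moves `E[ℓ]`, `ℓ` odd.**  Let `ℓ` be an odd good
supersingular prime of the minimal `W/ℚ`, `π^{ℓ²-1} = ℓ`, `s ∈ I_𝔓` with `s π = ξ π`.  If `s`
fixes `E[ℓ]` pointwise then `ξ = 1`: the parameter `t₀ = x₀/y₀` of a nonzero `P₀ ∈ E[ℓ]` has
`v(t₀) = v(π)` (`valuation_param_pow_eq`), so `t₀ = π w` with `w` a unit, and `s t₀ = t₀` gives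
`w = ξ · s w ≡ ξ w`. [cite: SerreInventiones1972, §1.11 Prop. 12] -/
theorem eq_one_of_forall_smul_eq_odd (hℓ2 : ℓ ≠ 2) (hΔ : ¬ (ℓ : ℤ) ∣ minimalDiscriminantInt W)
    (hss : (ℓ : ℤ) ∣ W.frobeniusTrace ℓ) {𝔓 : Ideal (absIntegers (𝓞 ℚ) ℚ)}
    (hmem : ∀ x : absIntegers (𝓞 ℚ) ℚ, x ∈ 𝔓 ↔ (x : AlgebraicClosure ℚ) ∈ (placeOver ℓ).nonunits)
    {s : absoluteGaloisGroup ℚ} (hs : s ∈ 𝔓.inertia (absoluteGaloisGroup ℚ))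
    {π ξ : AlgebraicClosure ℚ} (hπ : π ^ (ℓ ^ 2 - 1) = ℓ) (hsπ : s • π = ξ * π)
    (hfix : ∀ P : geomTorsion W ℓ, s • P = P) : ξ = 1 := by
  have hp : ℓ.Prime := Fact.out
  set v := (placeOver ℓ).valuation with hv
  set n := ℓ ^ 2 - 1 with hndef
  have hn : 0 < n := by
    have : 4 ≤ ℓ ^ 2 := by nlinarith [hp.two_le]
    omega
  have hξn := pow_eq_one_of_smul_eq_mul ℓ hn hπ hsπ
  have hξ0 : ξ ≠ 0 := fun h0 ↦ by rw [h0, zero_pow hn.ne'] at hξn; exact zero_ne_one hξn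
  have hvξ : v ξ = 1 :=
    pow_left_injective_of_ne_zero hn.ne' (by rw [← map_pow, hξn, map_one, one_pow])
  obtain ⟨P₀, x₀, y₀, h₀, hP₀xy⟩ := exists_ne_zero_geomTorsion ℓ (W := W)
  have hP₀t : (ℓ : ℤ) • (P₀ : W.geomPoints) = 0 := (Submodule.mem_torsionBy_iff _ _).mp P₀.2
  obtain ⟨-, ht₀n⟩ := valuation_param_pow_eq ℓ hΔ hss hℓ2 hP₀t hP₀xy
  set t₀ := x₀ / y₀ with ht₀def
  have hvℓ0 : v ℓ ≠ 0 := by rw [hv, Valuation.ne_zero_iff]; exact_mod_cast hp.ne_zero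
  have hvπ : v π = v t₀ := by
    have h1 : v π ^ n = v t₀ ^ n := by rw [← map_pow, hπ, ht₀n]
    exact pow_left_injective_of_ne_zero hn.ne' h1
  have ht₀0 : v t₀ ≠ 0 := by
    intro h0; rw [h0, zero_pow hn.ne'] at ht₀n; exact hvℓ0 ht₀n.symm
  have hπ0 : π ≠ 0 := fun h ↦ ht₀0 (by rw [← hvπ, h, map_zero])
  -- `s t₀ = t₀`
  have hst₀ : s • t₀ = t₀ := by
    have h1 : ((s • P₀ : geomTorsion W ℓ) : W.geomPoints) = (P₀ : W.geomPoints) := by rw [hfix P₀]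
    obtain ⟨h', hs'⟩ := exists_smul_eq_some (W := W) s hP₀xy
    have h2 : ((s • P₀ : geomTorsion W ℓ) : W.geomPoints) = s • (P₀ : W.geomPoints) := rfl
    rw [h2, hs', hP₀xy] at h1
    obtain ⟨hx, hy⟩ := (Affine.Point.some.injEq _ _ _ _ _ _).mp h1
    rw [ht₀def, ← smul_div_eq, hx, hy]
  -- `w = t₀ / π` is a unit with `w = ξ · s w`
  set w := t₀ / π with hw
  have hvw : v w = 1 := by rw [hw, map_div₀, hvπ, div_self ht₀0]
  have hwmem : w ∈ placeOver ℓ := (ValuationSubring.valuation_le_one_iff _ _).mp hvw.le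
  have hw0 : w ≠ 0 := fun h ↦ by rw [h, map_zero] at hvw; exact zero_ne_one hvw
  have ht₀w : t₀ = π * w := by rw [hw, mul_div_cancel₀ _ hπ0]
  have hkey : w = ξ * s • w := by
    have h1 : s • t₀ = ξ * π * s • w := by rw [ht₀w, smul_mul', hsπ]
    rw [hst₀, ht₀w] at h1
    exact mul_left_cancel₀ hπ0 (by rw [h1]; ring)
  have hvsw : v (s • w) = 1 := by
    have := congrArg v hkey
    rw [map_mul, hvξ, one_mul, hvw] at this
    exact this.symm
  -- inertia: `v (s w - w) < 1`, i.e. `v (1 - ξ) < 1`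
  have hlt := valuation_smul_sub_lt_one_of_mem_inertia hmem hs hwmem
  have hdiff : s • w - w = (1 - ξ) * s • w := by
    nth_rw 2 [hkey]
    ring
  rw [hdiff, map_mul, hvsw, mul_one, Valuation.map_sub_swap] at hlt
  exact eq_one_of_pow_eq_one_of_valuation_sub_one_lt ℓ (not_dvd_sq_sub_one ℓ) hξn hlt

/-- **An inertia element that moves `π` moves `E[ℓ]`** (every prime `ℓ` of good supersingular
reduction of the minimal `W/ℚ`; `π^{ℓ²-1} = ℓ`, `s ∈ I_𝔓`, `s π = ξ π`, `ξ ≠ 1`): some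
`P ∈ E[ℓ]` has `s P ≠ P`.  Serre 1972, §1.11 Prop. 12: the tame character of level `2` is
injective on the image of inertia. [cite: SerreInventiones1972, §1.11 Prop. 12] -/
theorem exists_smul_ne_of_smul_eq_mul (hΔ : ¬ (ℓ : ℤ) ∣ minimalDiscriminantInt W)
    (hss : (ℓ : ℤ) ∣ W.frobeniusTrace ℓ) {𝔓 : Ideal (absIntegers (𝓞 ℚ) ℚ)}
    (hmem : ∀ x : absIntegers (𝓞 ℚ) ℚ, x ∈ 𝔓 ↔ (x : AlgebraicClosure ℚ) ∈ (placeOver ℓ).nonunits)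
    {s : absoluteGaloisGroup ℚ} (hs : s ∈ 𝔓.inertia (absoluteGaloisGroup ℚ))
    {π ξ : AlgebraicClosure ℚ} (hπ : π ^ (ℓ ^ 2 - 1) = ℓ) (hsπ : s • π = ξ * π) (hξ : ξ ≠ 1) :
    ∃ P : geomTorsion W ℓ, s • P ≠ P := by
  by_contra hall
  push Not at hall
  rcases eq_or_ne ℓ 2 with hℓ2 | hℓ2
  · exact hξ (eq_one_of_forall_smul_eq_two ℓ hℓ2 hΔ hss hmem hs hπ hsπ hall)
  · exact hξ (eq_one_of_forall_smul_eq_odd ℓ hℓ2 hΔ hss hmem hs hπ hsπ hall)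

end Nontrivial

/-! ## §4 `ℓ = 2`: the image of inertia on `E[2]` is cyclic of order `3 = 2² - 1` -/

section InertiaTwo

/-- A type with four elements, four of them pairwise distinct: every element is one of the four.
[folklore] -/
private theorem eq_or_eq_or_eq_of_card_eq_four {T : Type*} (hT : Nat.card T = 4) {a b c d : T}
    (hab : a ≠ b) (hac : a ≠ c) (had : a ≠ d) (hbc : b ≠ c) (hbd : b ≠ d) (hcd : c ≠ d) (q : T) :
    q = a ∨ q = b ∨ q = c ∨ q = d := by
  classical
  haveI : Finite T := Nat.finite_of_card_ne_zero (by rw [hT]; norm_num)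
  haveI : Fintype T := Fintype.ofFinite T
  have hS : ({a, b, c, d} : Finset T).card = 4 := by
    rw [Finset.card_insert_of_notMem (by simp [hab, hac, had]),
      Finset.card_insert_of_notMem (by simp [hbc, hbd]), Finset.card_pair hcd]
  have huniv : ({a, b, c, d} : Finset T) = Finset.univ :=
    Finset.eq_univ_of_card _ (by rw [hS, ← Nat.card_eq_fintype_card, hT])
  have hq : q ∈ ({a, b, c, d} : Finset T) := huniv ▸ Finset.mem_univ q
  simpa [Finset.mem_insert, Finset.mem_singleton] using hq

variable (ℓ : ℕ) [Fact ℓ.Prime] {W : WeierstrassCurve ℚ} [W.IsGloballyMinimal] [W.IsElliptic]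

/-- **Serre 1972, §1.11 Prop. 12 c) at `p = 2`, at the place's prime, from the tame Kummer
character.**  Let `E = W/ℚ` be minimal with good supersingular reduction at `2` (`2 ∤ Δ`,
`2 ∣ a₂`), `𝔓` the prime of `\bar ℤ` cut out by `placeOver 2`, `I = I_𝔓`, and assume that for
`π³ = 2` and every cube root of unity `ζ` some `s ∈ I` has `s π = ζ π` (Kummer theory; the tree's
`exists_mem_inertia_smul_eq_mul_of_pow_eq`).  Then `ρ̄_{E,2}(I)` is **cyclic of order
`3 = 2² - 1`**.  Proof (Serre's, with the abscissa in place of the formal-group parameter): the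
Kummer cocycle `ψ(s) = s(π)/π ∈ μ₃` is a character of `I`; for `P = (x, y) ∈ E[2] ∖ 0` the element
`ε_P = π² x` is a `𝔓`-unit (`v(4)v(x)³ = 1`) with `s ε_P = ψ(s)² ε_{sP}`; as `s ∈ I` fixes
residues, `ε̄_{s₀P} = ζ ε̄_P` for the Kummer element `s₀`, so `P, s₀P, s₀²P` have distinct
residues `ε̄, ζε̄, ζ²ε̄` and are the three points of `E[2] ∖ 0`; hence `s ∈ I` fixes `E[2]` iff
`ψ(s) = 1`, i.e. `ρ̄(I) ≅ ψ(I) = μ₃`.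
[cite: SerreInventiones1972, §1.11 Prop. 12 c); §1.3 Prop. 1] -/
theorem isCyclic_and_card_inertia_map_of_dvd_frobeniusTrace_two (hℓ2 : ℓ = 2)
    (hΔ : ¬ (ℓ : ℤ) ∣ minimalDiscriminantInt W) (hss : (ℓ : ℤ) ∣ W.frobeniusTrace ℓ)
    {𝔓 : Ideal (absIntegers (𝓞 ℚ) ℚ)}
    (hmem : ∀ x : absIntegers (𝓞 ℚ) ℚ, x ∈ 𝔓 ↔ (x : AlgebraicClosure ℚ) ∈ (placeOver ℓ).nonunits)
    (hT : ∀ π ζ : AlgebraicClosure ℚ, π ^ (ℓ ^ 2 - 1) = ℓ → ζ ^ (ℓ ^ 2 - 1) = 1 →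
      ∃ s ∈ 𝔓.inertia (absoluteGaloisGroup ℚ), s • π = ζ * π) :
    IsCyclic ((𝔓.inertia (absoluteGaloisGroup ℚ)).map (galoisRepTorsion W ℓ)) ∧
      Nat.card ((𝔓.inertia (absoluteGaloisGroup ℚ)).map (galoisRepTorsion W ℓ)) = ℓ ^ 2 - 1 := by
  have hp : ℓ.Prime := Fact.out
  set v := (placeOver ℓ).valuation with hv
  set I := 𝔓.inertia (absoluteGaloisGroup ℚ) with hI
  set ρ := galoisRepTorsion W ℓ with hρ
  set n := ℓ ^ 2 - 1 with hn
  have hn3 : n = 3 := by rw [hn, hℓ2]; norm_num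
  have hnpos : 0 < n := by rw [hn3]; norm_num
  have hn0 : n ≠ 0 := hnpos.ne'
  have hnℓ : ¬ (ℓ : ℤ) ∣ (n : ℤ) := not_dvd_sq_sub_one ℓ
  have hℓ0 : ((ℓ : ℕ) : AlgebraicClosure ℚ) ≠ 0 := Nat.cast_ne_zero.mpr hp.ne_zero
  -- Kummer data: `π³ = 2`, `ζ` a primitive cube root of unity, `s₀ ∈ I` with `s₀ π = ζ π`
  obtain ⟨π, hπ⟩ := IsAlgClosed.exists_pow_nat_eq (ℓ : AlgebraicClosure ℚ) hnpos
  haveI : NeZero ((n : ℕ) : AlgebraicClosure ℚ) := ⟨Nat.cast_ne_zero.mpr hn0⟩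
  obtain ⟨ζ, hζ⟩ := IsAlgClosed.exists_root (cyclotomic n (AlgebraicClosure ℚ))
    (degree_cyclotomic_pos n _ hnpos).ne'
  have hζprim : IsPrimitiveRoot ζ n := isRoot_cyclotomic_iff.mp hζ
  obtain ⟨s₀, hs₀I, hs₀⟩ := hT π ζ hπ hζprim.pow_eq_one
  have hπ0 : π ≠ 0 := by
    rintro rfl; rw [zero_pow hn0] at hπ; exact hℓ0 hπ.symm
  have hζ1 : ζ ≠ 1 := hζprim.ne_one (by rw [hn3]; norm_num)
  have hζ2 : ζ ^ 2 ≠ 1 := hζprim.pow_ne_one_of_pos_of_lt two_ne_zero (by rw [hn3]; norm_num)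
  have hζ3 : ζ ^ 3 = 1 := by rw [← hn3]; exact hζprim.pow_eq_one
  have hζ4 : ζ ^ 4 = ζ := by
    calc ζ ^ 4 = ζ ^ 3 * ζ := by ring
      _ = ζ := by rw [hζ3, one_mul]
  have hvζ : v ζ = 1 :=
    pow_left_injective_of_ne_zero hn0 (by rw [← map_pow, hζprim.pow_eq_one, map_one, one_pow])
  -- roots of unity `≡ 1` are `= 1`; the unit trick
  have hroot1 : ∀ {a : AlgebraicClosure ℚ}, a ^ n = 1 → v (a - 1) < 1 → a = 1 :=
    fun ha hlt ↦ eq_one_of_pow_eq_one_of_valuation_sub_one_lt ℓ hnℓ ha hlt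
  have hunit : ∀ {a b : AlgebraicClosure ℚ}, v b = 1 → v (a * b - b) < 1 → v (a - 1) < 1 := by
    intro a b hb hlt
    rwa [← sub_one_mul, map_mul, hb, mul_one] at hlt
  have htrans : ∀ {A B C : AlgebraicClosure ℚ}, v (A - B) < 1 → v (B - C) < 1 → v (A - C) < 1 := by
    intro A B C h1 h2
    have : A - C = (A - B) + (B - C) := by ring
    rw [this]
    exact Valuation.map_add_lt _ h1 h2
  -- the cocycle `ψ s = s π / π`
  set ψ : absoluteGaloisGroup ℚ → AlgebraicClosure ℚ := fun s ↦ s • π / π with hψdef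
  have hψπ : ∀ s, s • π = ψ s * π := fun s ↦ by
    rw [hψdef]; dsimp only; rw [div_mul_cancel₀ _ hπ0]
  have hψn : ∀ s, ψ s ^ n = 1 := fun s ↦ pow_eq_one_of_smul_eq_mul ℓ hnpos hπ (hψπ s)
  have hψ0 : ∀ s, ψ s ≠ 0 := fun s h0 ↦ by
    have := hψn s; rw [h0, zero_pow hn0] at this; exact zero_ne_one this
  have hψs₀ : ψ s₀ = ζ := by
    have := hψπ s₀; rw [hs₀] at this; exact (mul_right_cancel₀ hπ0 this).symm
  -- inertia fixes cube roots of unity; `ψ` is multiplicative on `I`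
  have hfixμ : ∀ {s}, s ∈ I → ∀ {ξ : AlgebraicClosure ℚ}, ξ ^ n = 1 → s • ξ = ξ :=
    fun hs _ hξ ↦ smul_eq_self_of_pow_eq_one_of_mem_inertia' ℓ hmem hs hnℓ hξ
  have hmul : ∀ s s' : I, ψ (s * s') = ψ s * ψ s' := by
    rintro ⟨s, hs⟩ ⟨s', hs'⟩
    change ψ (s * s') = ψ s * ψ s'
    have h1 : (s * s') • π = ψ s * ψ s' * π := by
      rw [mul_smul, hψπ s', smul_mul', hfixμ hs (hψn s'), hψπ s]; ring
    rw [hψπ (s * s')] at h1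
    exact mul_right_cancel₀ hπ0 h1
  set ψI : I →* (AlgebraicClosure ℚ)ˣ :=
    MonoidHom.mk' (fun s ↦ Units.mk0 (ψ s) (hψ0 s)) (fun s s' ↦ Units.ext (by
      simp only [Units.val_mk0, Units.val_mul]; exact hmul s s')) with hψI
  have hψI_apply : ∀ s : I, (ψI s : AlgebraicClosure ℚ) = ψ s := fun s ↦ rfl
  -- torsion points: cardinality, coordinates, the units `ε = π² x`
  have hℓ' : (ℓ : AlgebraicClosure ℚ) ≠ 0 := hℓ0
  have hcard0 : Nat.card (geomTorsion W ℓ) = ℓ ^ 2 :=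
    card_torsionPoints_eq_sq_holds W (AlgebraicClosure ℚ) (n := ℓ) hℓ'
  have hcard : Nat.card (geomTorsion W ℓ) = 4 := by rw [hcard0, hℓ2]; norm_num
  have hPt : ∀ P : geomTorsion W ℓ, (ℓ : ℤ) • (P : W.geomPoints) = 0 := fun P ↦
    (Submodule.mem_torsionBy_iff _ _).mp P.2
  have hcoords : ∀ {P : geomTorsion W ℓ}, P ≠ 0 →
      ∃ (x y : AlgebraicClosure ℚ) (h : _), (P : W.geomPoints) = .some x y h := by
    intro P hP0
    have hP0' : (P : W.geomPoints) ≠ 0 := fun h ↦ hP0 (Subtype.ext h)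
    obtain ⟨x, y, h, hPxy⟩ := geomPoints.exists_eq_some (P := (P : W.geomPoints)) hP0'
    exact ⟨x, y, h, hPxy⟩
  have hsP : ∀ (s : absoluteGaloisGroup ℚ) (P : geomTorsion W ℓ) {x y : AlgebraicClosure ℚ} {h},
      (P : W.geomPoints) = .some x y h →
      ∃ h', ((s • P : geomTorsion W ℓ) : W.geomPoints) = .some (s • x) (s • y) h' :=
    fun s P x y h hPxy ↦ exists_smul_eq_some (W := W) s hPxy
  have hxeq : ∀ {Q Q' : geomTorsion W ℓ} {x' y' x'' y'' : AlgebraicClosure ℚ} {h' h''},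
      (Q : W.geomPoints) = .some x' y' h' → (Q' : W.geomPoints) = .some x'' y'' h'' → Q = Q' →
      x' = x'' := by
    intro Q Q' x' y' x'' y'' h' h'' hQ hQ' hQQ'
    have h1 : (Q : W.geomPoints) = (Q' : W.geomPoints) := by rw [hQQ']
    rw [hQ, hQ'] at h1
    exact ((Affine.Point.some.injEq _ _ _ _ _ _).mp h1).1
  have hε : ∀ (P : geomTorsion W ℓ) {x y : AlgebraicClosure ℚ} {h},
      (P : W.geomPoints) = .some x y h → v (π ^ 2 * x) = 1 := fun P x y h hPxy ↦
    valuation_sq_mul_X_eq_one ℓ hℓ2 hΔ hss hπ (hPt P) hPxy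
  -- inertia fixes residues: `v (ψ(s)² ε(sP) - ε(P)) < 1`
  have hres : ∀ {s : absoluteGaloisGroup ℚ}, s ∈ I → ∀ (P : geomTorsion W ℓ)
      {x y : AlgebraicClosure ℚ} {h}, (P : W.geomPoints) = .some x y h →
      v (ψ s ^ 2 * (π ^ 2 * s • x) - π ^ 2 * x) < 1 := by
    intro s hs P x y h hPxy
    have hmem1 : π ^ 2 * x ∈ placeOver ℓ :=
      (ValuationSubring.valuation_le_one_iff _ _).mp (hε P hPxy).le
    have h1 := valuation_smul_sub_lt_one_of_mem_inertia hmem hs hmem1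
    have hmove : s • (π ^ 2 * x) = ψ s ^ 2 * (π ^ 2 * s • x) := by
      rw [smul_mul', smul_pow', hψπ s]; ring
    rwa [hmove] at h1
  -- CLAIM B: `ψ(s) = 1 ⇒ s` fixes `E[2]` pointwise
  have hB : ∀ {s : absoluteGaloisGroup ℚ}, s ∈ I → ψ s = 1 → ∀ P : geomTorsion W ℓ, s • P = P := by
    intro s hs hψ1 P
    by_cases hP0 : P = 0
    · rw [hP0, smul_zero]
    by_contra hne
    obtain ⟨x, y, h, hPxy⟩ := hcoords hP0
    -- the three points `P, P₁ = s₀ P, P₂ = s₀² P`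
    set P₁ : geomTorsion W ℓ := s₀ • P with hP₁
    set P₂ : geomTorsion W ℓ := s₀ • P₁ with hP₂
    obtain ⟨h₁, hP₁xy⟩ := hsP s₀ P hPxy
    obtain ⟨h₂, hP₂xy⟩ := hsP s₀ P₁ hP₁xy
    obtain ⟨h', hsPxy⟩ := hsP s P hPxy
    set x₁ := s₀ • x with hx₁
    set x₂ := s₀ • x₁ with hx₂
    have hε0 := hε P hPxy
    have hε1 := hε P₁ hP₁xy
    have hε2 := hε P₂ hP₂xy
    -- residues: `ζ² ε₁ ≡ ε`, `ζ² ε₂ ≡ ε₁`, hence `ζ ε₂ ≡ ε`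
    have hr1 : v (ζ ^ 2 * (π ^ 2 * x₁) - π ^ 2 * x) < 1 := by
      have := hres hs₀I P hPxy; rwa [hψs₀] at this
    have hr2 : v (ζ ^ 2 * (π ^ 2 * x₂) - π ^ 2 * x₁) < 1 := by
      have := hres hs₀I P₁ hP₁xy; rwa [hψs₀] at this
    have hr3 : v (ζ * (π ^ 2 * x₂) - π ^ 2 * x) < 1 := by
      have h2' : v (ζ ^ 4 * (π ^ 2 * x₂) - ζ ^ 2 * (π ^ 2 * x₁)) < 1 := by
        have : ζ ^ 4 * (π ^ 2 * x₂) - ζ ^ 2 * (π ^ 2 * x₁) =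
            ζ ^ 2 * (ζ ^ 2 * (π ^ 2 * x₂) - π ^ 2 * x₁) := by ring
        rw [this, map_mul, map_pow, hvζ, one_pow, one_mul]
        exact hr2
      rw [hζ4] at h2'
      exact htrans h2' hr1
    -- the points `0, P, P₁, P₂` are pairwise distinct
    have h0P : (0 : geomTorsion W ℓ) ≠ P := fun h ↦ hP0 h.symm
    have h0P₁ : (0 : geomTorsion W ℓ) ≠ P₁ := fun h ↦ hP0 ((smul_eq_zero_iff_eq s₀).mp h.symm)
    have h0P₂ : (0 : geomTorsion W ℓ) ≠ P₂ := fun h ↦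
      hP0 ((smul_eq_zero_iff_eq s₀).mp ((smul_eq_zero_iff_eq s₀).mp h.symm))
    have hPP₁ : P ≠ P₁ := by
      intro heq
      have hx : x = x₁ := hxeq hPxy hP₁xy heq
      rw [← hx] at hr1
      exact hζ2 (hroot1 (by rw [← pow_mul, mul_comm, pow_mul, hζprim.pow_eq_one, one_pow])
        (hunit hε0 hr1))
    have hP₁P₂ : P₁ ≠ P₂ := by
      intro heq
      have hx : x₁ = x₂ := hxeq hP₁xy hP₂xy heq
      rw [← hx] at hr2
      exact hζ2 (hroot1 (by rw [← pow_mul, mul_comm, pow_mul, hζprim.pow_eq_one, one_pow])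
        (hunit hε1 hr2))
    have hPP₂ : P ≠ P₂ := by
      intro heq
      have hx : x = x₂ := hxeq hPxy hP₂xy heq
      rw [← hx] at hr3
      exact hζ1 (hroot1 hζprim.pow_eq_one (hunit hε0 hr3))
    -- `ψ(s) = 1`: `ε(sP) ≡ ε(P)`
    have hr0 : v (π ^ 2 * s • x - π ^ 2 * x) < 1 := by
      have := hres hs P hPxy; rwa [hψ1, one_pow, one_mul] at this
    -- where is `s P`?
    rcases eq_or_eq_or_eq_of_card_eq_four hcard h0P h0P₁ h0P₂ hPP₁ hPP₂ hP₁P₂ (s • P) with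
      hq | hq | hq | hq
    · exact hP0 ((smul_eq_zero_iff_eq s).mp hq)
    · exact hne hq
    · have hx : s • x = x₁ := hxeq hsPxy hP₁xy hq
      rw [hx] at hr0
      -- `ε₁ ≡ ε` and `ζ² ε₁ ≡ ε` give `ζ² ≡ 1`
      have h3 : v (ζ ^ 2 * (π ^ 2 * x₁) - π ^ 2 * x₁) < 1 := by
        have := htrans hr1 (show v (π ^ 2 * x - π ^ 2 * x₁) < 1 by
          rw [Valuation.map_sub_swap]; exact hr0)
        exact this
      exact hζ2 (hroot1 (by rw [← pow_mul, mul_comm, pow_mul, hζprim.pow_eq_one, one_pow])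
        (hunit hε1 h3))
    · have hx : s • x = x₂ := hxeq hsPxy hP₂xy hq
      rw [hx] at hr0
      have h3 : v (ζ * (π ^ 2 * x₂) - π ^ 2 * x₂) < 1 :=
        htrans hr3 (show v (π ^ 2 * x - π ^ 2 * x₂) < 1 by
          rw [Valuation.map_sub_swap]; exact hr0)
      exact hζ1 (hroot1 hζprim.pow_eq_one (hunit hε2 h3))
  -- the key equivalence: `ρ̄(s) = 1 ↔ ψ(s) = 1`
  have hker : ∀ s : I, ρ s = 1 ↔ ψI s = 1 := by
    rintro ⟨s, hs⟩
    rw [galoisRepTorsion_eq_one_iff', Units.ext_iff, hψI_apply, Units.val_one]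
    change (∀ P : geomTorsion W ℓ, s • P = P) ↔ ψ s = 1
    constructor
    · intro hall
      exact eq_one_of_forall_smul_eq_two ℓ hℓ2 hΔ hss hmem hs hπ (hψπ s) hall
    · intro h1
      exact hB hs h1
  have hkereq : (ρ.restrict I).ker = ψI.ker := by
    ext s
    rw [MonoidHom.mem_ker, MonoidHom.mem_ker, MonoidHom.restrict_apply]
    exact hker s
  -- `ρ̄(I) ≃ ψ(I)`
  have e : (ρ.restrict I).range ≃* ψI.range :=
    (QuotientGroup.quotientKerEquivRange _).symm.trans
      ((QuotientGroup.quotientMulEquivOfEq hkereq).trans (QuotientGroup.quotientKerEquivRange _))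
  have hH : I.map ρ = (ρ.restrict I).range := (MonoidHom.restrict_range (K := I) (f := ρ)).symm
  -- `ψ(I) ≤ μ_n`
  have hle : ψI.range ≤ rootsOfUnity n (AlgebraicClosure ℚ) := by
    rintro _ ⟨s, rfl⟩
    rw [mem_rootsOfUnity, Units.ext_iff, Units.val_pow_eq_pow_val, hψI_apply, Units.val_one]
    exact hψn s
  haveI : NeZero n := ⟨hn0⟩
  haveI : Finite ψI.range :=
    Finite.of_injective (Subgroup.inclusion hle) (Subgroup.inclusion_injective hle)
  have hRle : Nat.card ψI.range ≤ n :=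
    (Subgroup.card_le_of_le hle).trans (card_rootsOfUnity _ n)
  -- an element of order `n`: `ψ(s₀) = ζ`
  have hprim : IsPrimitiveRoot (ψI ⟨s₀, hs₀I⟩) n := by
    refine ⟨?_, fun l hl ↦ hζprim.dvd_of_pow_eq_one l ?_⟩
    · rw [Units.ext_iff, Units.val_pow_eq_pow_val, hψI_apply, Units.val_one]
      exact hψn s₀
    · rw [Units.ext_iff, Units.val_pow_eq_pow_val, hψI_apply, Units.val_one] at hl
      change ψ s₀ ^ l = 1 at hl
      rwa [hψs₀] at hl
  set R := ψI.range with hR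
  set g : R := ⟨ψI ⟨s₀, hs₀I⟩, ⟨⟨s₀, hs₀I⟩, rfl⟩⟩ with hg
  have hordg : orderOf g = n := by
    have h1 : orderOf (R.subtype g) = orderOf g :=
      orderOf_injective R.subtype Subtype.coe_injective g
    rw [← h1]
    exact hprim.eq_orderOf.symm
  have hRcyc : IsCyclic R := isCyclic_of_card_le_orderOf g (by rw [hordg]; exact hRle)
  have hRcard : Nat.card R = n := by
    refine le_antisymm hRle ?_
    rw [← hordg]
    exact Nat.le_of_dvd Nat.card_pos (orderOf_dvd_natCard g)
  -- transfer to `ρ̄(I)`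
  rw [hH]
  refine ⟨isCyclic_of_surjective e.symm e.symm.surjective, ?_⟩
  rw [Nat.card_congr e.toEquiv, hRcard]

/-- **Serre 1972, §1.11 Prop. 12 c) at the place's prime, every prime `ℓ`** (minimal `W/ℚ`, good
supersingular reduction at `ℓ`; Kummer input `hT` as in the tree's odd-`ℓ` theorem
`isCyclic_and_card_inertia_map_of_dvd_frobeniusTrace`, which this extends by the case `ℓ = 2`):
`ρ̄_{E,ℓ}(I_𝔓)` is cyclic of order `ℓ² - 1`. [cite: SerreInventiones1972, §1.11 Prop. 12 c)] -/
theorem isCyclic_and_card_inertia_map_of_dvd_frobeniusTrace_all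
    (hΔ : ¬ (ℓ : ℤ) ∣ minimalDiscriminantInt W) (hss : (ℓ : ℤ) ∣ W.frobeniusTrace ℓ)
    {𝔓 : Ideal (absIntegers (𝓞 ℚ) ℚ)}
    (hmem : ∀ x : absIntegers (𝓞 ℚ) ℚ, x ∈ 𝔓 ↔ (x : AlgebraicClosure ℚ) ∈ (placeOver ℓ).nonunits)
    (hT : ∀ π ζ : AlgebraicClosure ℚ, π ^ (ℓ ^ 2 - 1) = ℓ → ζ ^ (ℓ ^ 2 - 1) = 1 →
      ∃ s ∈ 𝔓.inertia (absoluteGaloisGroup ℚ), s • π = ζ * π) :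
    IsCyclic ((𝔓.inertia (absoluteGaloisGroup ℚ)).map (galoisRepTorsion W ℓ)) ∧
      Nat.card ((𝔓.inertia (absoluteGaloisGroup ℚ)).map (galoisRepTorsion W ℓ)) = ℓ ^ 2 - 1 := by
  rcases eq_or_ne ℓ 2 with hℓ2 | hℓ2
  · exact isCyclic_and_card_inertia_map_of_dvd_frobeniusTrace_two ℓ hℓ2 hΔ hss hmem hT
  · exact isCyclic_and_card_inertia_map_of_dvd_frobeniusTrace ℓ hΔ hss hℓ2 hmem hT

end InertiaTwo

/-! ## §5 A Frobenius at `𝔓` does not act on `E[ℓ]` through the inertia group -/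

section Frobenius

variable (ℓ : ℕ) [Fact ℓ.Prime] {W : WeierstrassCurve ℚ} [W.IsGloballyMinimal] [W.IsElliptic]

omit [Fact ℓ.Prime] in
/-- Conjugating an element of `I_𝔓` by an element of the decomposition group (`τ • 𝔓 = 𝔓`) gives
an element of `I_𝔓` (a copy of the tree's `conj_mem_inertia_of_smul_eq`,
`SupersingularUnramifiedNonabelianProofs`, kept here to keep the imports light); Neukirch, *Algebraic
Number Theory*, Ch. I §9, (9.4): `G_{σ𝔓} = σ G_𝔓 σ⁻¹`, `I_{σ𝔓} = σ I_𝔓 σ⁻¹`.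
[cite: NeukirchANT1999, Ch. I §9 (9.4)] -/
theorem conj_mem_inertia_of_smul_eq' {𝔓 : Ideal (absIntegers (𝓞 ℚ) ℚ)}
    {σ τ : absoluteGaloisGroup ℚ} (hσ : σ ∈ 𝔓.inertia (absoluteGaloisGroup ℚ))
    (hτ : τ • 𝔓 = 𝔓) : τ * σ * τ⁻¹ ∈ 𝔓.inertia (absoluteGaloisGroup ℚ) := by
  rw [Ideal.inertia, AddSubgroup.mem_inertia] at hσ ⊢
  intro b
  have h1 : σ • (τ⁻¹ • b) - τ⁻¹ • b ∈ 𝔓 := hσ _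
  have h2 : τ • (σ • (τ⁻¹ • b) - τ⁻¹ • b) ∈ τ • 𝔓 := Ideal.smul_mem_pointwise_smul_iff.mpr h1
  rw [hτ, smul_sub, smul_inv_smul] at h2
  rwa [mul_smul, mul_smul]

omit [Fact ℓ.Prime] in
/-- The decomposition group normalises the inertia group: `D_𝔓 ≤ N(I_𝔓)` (Neukirch, *Algebraic
Number Theory*, Ch. I §9, (9.4) with `σ ∈ G_𝔓`: `I_𝔓 = I_{σ𝔓} = σ I_𝔓 σ⁻¹`; `I_𝔓` is the kernel of
`G_𝔓 → Gal(κ(𝔓)/κ(p))`, Prop. (9.6)). [cite: NeukirchANT1999, Ch. I §9 (9.4) and Prop. (9.6)] -/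
theorem decompositionSubgroup_le_normalizer_inertia (𝔓 : Ideal (absIntegers (𝓞 ℚ) ℚ)) :
    𝔓.decompositionSubgroup (absoluteGaloisGroup ℚ) ≤
      Subgroup.normalizer (𝔓.inertia (absoluteGaloisGroup ℚ) : Set (absoluteGaloisGroup ℚ)) := by
  intro τ hτ
  rw [Ideal.mem_decompositionSubgroup_iff] at hτ
  rw [Subgroup.mem_normalizer_iff]
  intro σ
  constructor
  · exact fun hσ ↦ conj_mem_inertia_of_smul_eq' hσ hτ
  · intro hσ
    have hσ' : τ * σ * τ⁻¹ ∈ (τ • 𝔓).inertia (absoluteGaloisGroup ℚ) := by rwa [hτ]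
    have h1 := DegreeOnePrimes.conj_mem_inertia_of_mem_inertia_smul hσ'
    have h2 : τ⁻¹ * (τ * σ * τ⁻¹) * τ = σ := by group
    rwa [h2] at h1

omit [Fact ℓ.Prime] in
/-- `N v = ℓ` for the place `v` of `ℚ` over `ℓ` (a copy of the tree's
`Rat.residueCard_eq_natGenerator`, kept here to keep the imports light). [folklore] -/
private theorem residueCard_eq_of_primesEquiv_eq {v : HeightOneSpectrum (𝓞 ℚ)}
    (hv : (primesEquiv v : ℕ) = ℓ) : v.residueCard = ℓ := by
  rw [v.residueCard_eq_card_quotient]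
  have h : Ideal.span {(natGenerator v : ℤ)} =
      v.asIdeal.map (Rat.IsIntegralClosure.intEquiv (𝓞 ℚ) : 𝓞 ℚ →+* ℤ) :=
    span_natGenerator v
  rw [Nat.card_congr ((Ideal.quotientEquiv _ _ (Rat.IsIntegralClosure.intEquiv (𝓞 ℚ)) h).trans
    (Int.quotientSpanNatEquivZMod _)).toEquiv, Nat.card_zmod, ← hv]
  rfl

/-- **A Frobenius at `𝔓 ∣ ℓ` does not act on `E[ℓ]` as any element of the inertia group**, at a
good supersingular prime `ℓ` of the minimal `W/ℚ` (Serre 1972, §1.11 Prop. 12 (d) with §2.2: the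
image of the decomposition group is the NORMALISER of the non-split Cartan subgroup `C = ρ̄(I_𝔓)`,
not `C` itself, because the residue field `𝔽_ℓ` does not contain `𝔽_{ℓ²}`).  Concretely: for
the Kummer element `s₀ ∈ I_𝔓` (`s₀ π = ζ π`, `π^{ℓ²-1} = ℓ`, `ζ` primitive) and an arithmetic
Frobenius `φ` at `𝔓`, `φ s₀ φ⁻¹` moves `π` by `ζ^ℓ` (`φ ζ = ζ^ℓ`); if `φ` acted on `E[ℓ]` as
some `τ ∈ I_𝔓`, then `φ s₀ φ⁻¹` and `τ s₀ τ⁻¹` (which moves `π` by `ζ`) would agree on `E[ℓ]`, and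
their quotient — an inertia element moving `π` by `ζ^{ℓ-1} ≠ 1` — would fix `E[ℓ]`, contradicting
`exists_smul_ne_of_smul_eq_mul`. [cite: SerreInventiones1972, §1.11 Prop. 12 (d); §2.2] -/
theorem exists_mem_decompositionSubgroup_forall_exists_smul_ne
    (hΔ : ¬ (ℓ : ℤ) ∣ minimalDiscriminantInt W) (hss : (ℓ : ℤ) ∣ W.frobeniusTrace ℓ)
    {v : HeightOneSpectrum (𝓞 ℚ)} (hv : (primesEquiv v : ℕ) = ℓ)
    {𝔓 : Ideal (absIntegers (𝓞 ℚ) ℚ)}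
    (hmem : ∀ x : absIntegers (𝓞 ℚ) ℚ, x ∈ 𝔓 ↔ (x : AlgebraicClosure ℚ) ∈ (placeOver ℓ).nonunits)
    (h𝔓 : 𝔓 ∈ v.primesAbove) :
    ∃ φ ∈ 𝔓.decompositionSubgroup (absoluteGaloisGroup ℚ),
      ∀ τ ∈ 𝔓.inertia (absoluteGaloisGroup ℚ), ∃ P : geomTorsion W ℓ, τ • P ≠ φ • P := by
  have hp : ℓ.Prime := Fact.out
  set w := (placeOver ℓ).valuation with hw
  set I := 𝔓.inertia (absoluteGaloisGroup ℚ) with hI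
  set n := ℓ ^ 2 - 1 with hn
  have hnpos : 0 < n := by
    have : 4 ≤ ℓ ^ 2 := by nlinarith [hp.two_le]
    omega
  have hn0 : n ≠ 0 := hnpos.ne'
  have hnℓ : ¬ (ℓ : ℤ) ∣ (n : ℤ) := not_dvd_sq_sub_one ℓ
  have hℓ0 : ((ℓ : ℕ) : AlgebraicClosure ℚ) ≠ 0 := Nat.cast_ne_zero.mpr hp.ne_zero
  -- Kummer data
  obtain ⟨π, hπ⟩ := IsAlgClosed.exists_pow_nat_eq (ℓ : AlgebraicClosure ℚ) hnpos
  haveI : NeZero ((n : ℕ) : AlgebraicClosure ℚ) := ⟨Nat.cast_ne_zero.mpr hn0⟩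
  obtain ⟨ζ, hζ⟩ := IsAlgClosed.exists_root (cyclotomic n (AlgebraicClosure ℚ))
    (degree_cyclotomic_pos n _ hnpos).ne'
  have hζprim : IsPrimitiveRoot ζ n := isRoot_cyclotomic_iff.mp hζ
  obtain ⟨s₀, hs₀I, hs₀⟩ :=
    exists_mem_inertia_smul_eq_mul_of_pow_eq ℓ hnpos hv h𝔓 hπ hζprim.pow_eq_one
  have hπ0 : π ≠ 0 := by
    rintro rfl; rw [zero_pow hn0] at hπ; exact hℓ0 hπ.symm
  have hζ0 : ζ ≠ 0 := hζprim.ne_zero hn0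
  have hfixμ : ∀ {s}, s ∈ I → ∀ {ξ : AlgebraicClosure ℚ}, ξ ^ n = 1 → s • ξ = ξ :=
    fun hs _ hξ ↦ smul_eq_self_of_pow_eq_one_of_mem_inertia' ℓ hmem hs hnℓ hξ
  -- a Frobenius `φ ∈ D_𝔓` with `φ ζ = ζ ^ ℓ`
  obtain ⟨φ, hφ⟩ := HeightOneSpectrum.exists_isArithFrobAt_of_mem_primesAbove_holds h𝔓
  haveI := h𝔓.1
  have hφD : φ • 𝔓 = 𝔓 := hφ.mem_stabilizer
  have hζint : ζ ∈ absIntegers (𝓞 ℚ) ℚ := by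
    change ζ ∈ integralClosure (𝓞 ℚ) (AlgebraicClosure ℚ)
    rw [mem_integralClosure_iff]
    exact IsIntegral.of_pow hnpos (by rw [hζprim.pow_eq_one]; exact isIntegral_one)
  set z : absIntegers (𝓞 ℚ) ℚ := ⟨ζ, hζint⟩ with hzdef
  have hz : z ^ n = 1 := Subtype.ext (by
    change ζ ^ n = 1
    exact hζprim.pow_eq_one)
  have hn𝔓 : ((n : ℕ) : absIntegers (𝓞 ℚ) ℚ) ∉ 𝔓 := by
    rw [hmem, ValuationSubring.mem_nonunits_iff, not_lt]
    have h1 : w (n : AlgebraicClosure ℚ) = 1 := by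
      have := valuation_placeOver_intCast_eq_one ℓ hnℓ
      rwa [Int.cast_natCast] at this
    change 1 ≤ w (((n : ℕ) : absIntegers (𝓞 ℚ) ℚ) : AlgebraicClosure ℚ)
    rw [show (((n : ℕ) : absIntegers (𝓞 ℚ) ℚ) : AlgebraicClosure ℚ) = (n : AlgebraicClosure ℚ) by
      simp, h1]
  have hφζ : φ • ζ = ζ ^ ℓ := by
    have h1 := AlgHom.IsArithFrobAt.apply_of_pow_eq_one hφ hz hn𝔓
    rw [HeightOneSpectrum.card_quotient_under_eq_residueCard h𝔓,
      residueCard_eq_of_primesEquiv_eq ℓ hv] at h1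
    have h3 : (((MulSemiringAction.toAlgHom (𝓞 ℚ) (absIntegers (𝓞 ℚ) ℚ) φ) z :
        absIntegers (𝓞 ℚ) ℚ) : AlgebraicClosure ℚ) = φ • ζ := rfl
    have h4 : ((z ^ ℓ : absIntegers (𝓞 ℚ) ℚ) : AlgebraicClosure ℚ) = ζ ^ ℓ := rfl
    rw [← h3, ← h4]
    exact congrArg Subtype.val h1
  -- `τ₁ = φ s₀ φ⁻¹ ∈ I` moves `π` by `ζ ^ ℓ`
  set τ₁ := φ * s₀ * φ⁻¹ with hτ₁
  have hτ₁I : τ₁ ∈ I := conj_mem_inertia_of_smul_eq' hs₀I hφD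
  have hτ₁π : τ₁ • π = ζ ^ ℓ * π := by
    obtain ⟨ζ₁, hζ₁n, hζ₁⟩ := exists_smul_eq_mul_of_pow_eq ℓ hnpos hπ φ⁻¹
    have hs₀ζ₁ : s₀ • ζ₁ = ζ₁ := hfixμ hs₀I hζ₁n
    have hφback : φ • (ζ₁ * π) = π := by rw [← hζ₁, smul_inv_smul]
    calc τ₁ • π = φ • (s₀ • (φ⁻¹ • π)) := by rw [hτ₁, mul_smul, mul_smul]
      _ = φ • (ζ₁ * (ζ * π)) := by rw [hζ₁, smul_mul', hs₀ζ₁, hs₀]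
      _ = φ • (ζ * (ζ₁ * π)) := by rw [mul_left_comm]
      _ = φ • ζ * φ • (ζ₁ * π) := smul_mul' φ ζ (ζ₁ * π)
      _ = ζ ^ ℓ * π := by rw [hφζ, hφback]
  refine ⟨φ, Ideal.mem_decompositionSubgroup_iff.mpr hφD, fun τ hτ ↦ ?_⟩
  by_contra hall
  push Not at hall
  -- `φ⁻¹` acts as `τ⁻¹`, and `τ₁` as `τ s₀ τ⁻¹`, on `E[ℓ]`
  have hinv : ∀ P : geomTorsion W ℓ, φ⁻¹ • P = τ⁻¹ • P := by
    intro P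
    have h1 : τ • (φ⁻¹ • P) = P := by rw [hall, smul_inv_smul]
    exact eq_inv_smul_iff.mpr h1
  have hτD : τ • 𝔓 = 𝔓 := Ideal.mem_decompositionSubgroup_iff.mp
    (Ideal.inertia_le_decompositionSubgroup (G := absoluteGaloisGroup ℚ) (𝔓 := 𝔓) hτ)
  have hτs₀I : τ * s₀ * τ⁻¹ ∈ I := conj_mem_inertia_of_smul_eq' hs₀I hτD
  set g := (τ * s₀ * τ⁻¹)⁻¹ * τ₁ with hg
  have hgI : g ∈ I := I.mul_mem (I.inv_mem hτs₀I) hτ₁I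
  have hgfix : ∀ P : geomTorsion W ℓ, g • P = P := by
    intro P
    have h1 : τ₁ • P = (τ * s₀ * τ⁻¹) • P := by
      rw [hτ₁, mul_smul, mul_smul, hinv, ← hall, mul_smul, mul_smul]
    rw [hg, mul_smul, h1, inv_smul_smul]
  -- `g` moves `π` by `ζ^ℓ ζ⁻¹ ≠ 1`
  have hτs₀π : (τ * s₀ * τ⁻¹) • π = ζ * π := by
    obtain ⟨ξ, hξn, hξ⟩ := exists_smul_eq_mul_of_pow_eq ℓ hnpos hπ τ⁻¹
    have hτI' : τ⁻¹ ∈ I := I.inv_mem hτ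
    have hξ0 : ξ ≠ 0 := fun h0 ↦ by rw [h0, zero_pow hn0] at hξn; exact zero_ne_one hξn
    have hτπ : τ • π = ξ⁻¹ * π := by
      have h1 : τ • (ξ * π) = π := by rw [← hξ, smul_inv_smul]
      rw [smul_mul', hfixμ hτ hξn] at h1
      rw [eq_inv_mul_iff_mul_eq₀ hξ0, h1]
    calc (τ * s₀ * τ⁻¹) • π = τ • (s₀ • (τ⁻¹ • π)) := by rw [mul_smul, mul_smul]
      _ = τ • (ξ * (ζ * π)) := by rw [hξ, smul_mul', hfixμ hs₀I hξn, hs₀]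
      _ = ξ * (ζ * (ξ⁻¹ * π)) := by
          rw [smul_mul', smul_mul', hfixμ hτ hξn, hfixμ hτ hζprim.pow_eq_one, hτπ]
      _ = ζ * π := by field_simp
  have hgπ : g • π = (ζ ^ ℓ * ζ⁻¹) * π := by
    have hinvπ : (τ * s₀ * τ⁻¹)⁻¹ • π = ζ⁻¹ * π := by
      have hζinv : (ζ⁻¹) ^ n = 1 := by rw [inv_pow, hζprim.pow_eq_one, inv_one]
      rw [inv_smul_eq_iff, smul_mul', hfixμ hτs₀I hζinv, hτs₀π, ← mul_assoc, inv_mul_cancel₀ hζ0,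
        one_mul]
    have hζℓ : (ζ ^ ℓ) ^ n = 1 := by rw [← pow_mul, mul_comm, pow_mul, hζprim.pow_eq_one, one_pow]
    rw [hg, mul_smul, hτ₁π, smul_mul', hfixμ (I.inv_mem hτs₀I) hζℓ, hinvπ, mul_assoc]
  have hne1 : ζ ^ ℓ * ζ⁻¹ ≠ 1 := by
    intro h
    rw [mul_inv_eq_one₀ hζ0] at h
    have h1 : ζ ^ (ℓ - 1) = 1 := by
      have h2 : ζ ^ (ℓ - 1) * ζ = 1 * ζ := by
        rw [← pow_succ, Nat.sub_add_cancel hp.one_le, h, one_mul]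
      exact mul_right_cancel₀ hζ0 h2
    have hlt : ℓ - 1 < n := by
      have : ℓ < ℓ ^ 2 := by nlinarith [hp.two_le]
      omega
    exact hζprim.pow_ne_one_of_pos_of_lt (by have := hp.two_le; omega) hlt h1
  obtain ⟨P, hP⟩ := exists_smul_ne_of_smul_eq_mul ℓ hΔ hss hmem hgI hπ hgπ hne1
  exact hP (hgfix P)

end Frobenius

/-! ## §6 Group theory in `GL₂(𝔽_p)`: a subgroup strictly between a cyclic subgroup of order
`p² - 1` and its normaliser IS the normaliser, of order `2(p² - 1)` -/

section GL2

open Literature.NumberTheory.GaloisRepresentations.Serre1972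

/-- **Serre 1972, §2.1 b) + §2.2 (`(N : C) = 2`).**  In `GL₂(𝔽_p)`, let `C` be cyclic of order
`p² - 1` (a non-split Cartan subgroup, `exists_isField_eq_unitGroup_of_isCyclic`) and `N` a
subgroup with `C ≤ N ≤ N(C)` and `N ≠ C`.  Then `#N = 2(p² - 1)`
(`relIndex_unitGroup_normalizer`: `(N(C) : C) = 2`). [cite: SerreInventiones1972, §2.1 b), §2.2] -/
theorem card_eq_two_mul_of_isCyclic_of_le_normalizer {p : ℕ} [Fact p.Prime]
    {C N : Subgroup (GL (Fin 2) (ZMod p))} (hcyc : IsCyclic C) (hcard : Nat.card C = p ^ 2 - 1)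
    (hCN : C ≤ N) (hN : N ≤ Subgroup.normalizer (C : Set (GL (Fin 2) (ZMod p))))
    (hne : ¬ N ≤ C) : Nat.card N = 2 * (p ^ 2 - 1) := by
  obtain ⟨k, hk, h2, hCk⟩ := exists_isField_eq_unitGroup_of_isCyclic hcyc hcard
  obtain ⟨y₀, hy₀, hys⟩ := exists_mem_forall_ne_smul_one h2
  have hidx : (unitGroup k).relIndex
      (Subgroup.normalizer (unitGroup k : Set (GL (Fin 2) (ZMod p)))) = 2 :=
    relIndex_unitGroup_normalizer hk h2 hy₀ hys
      (trace_sq_sub_four_det_ne_zero_of_isField hk hy₀ hys)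
  rw [← hCk] at hidx
  have hmul := Subgroup.relIndex_mul_relIndex C N
    (Subgroup.normalizer (C : Set (GL (Fin 2) (ZMod p)))) hCN hN
  rw [hidx] at hmul
  have h1 : C.relIndex N ≠ 1 := by rwa [Ne, Subgroup.relIndex_eq_one]
  have h2' : C.relIndex N = 2 := by
    have hdvd : C.relIndex N ∣ 2 := Dvd.intro _ hmul
    rcases (Nat.dvd_prime Nat.prime_two).mp hdvd with h | h
    · exact absurd h h1
    · exact h
  have hcard' : Nat.card (C.subgroupOf N) = p ^ 2 - 1 := by
    rw [Nat.card_congr (Subgroup.subgroupOfEquivOfLe hCN).toEquiv, hcard]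
  have := (C.subgroupOf N).card_mul_index
  rw [hcard', ← Subgroup.relIndex, h2'] at this
  omega

/-- Isomorphic images: if two homomorphisms `f`, `g` have the same kernel on `H`, then
`f(H) ≃ g(H)`. [folklore] -/
private theorem nonempty_mulEquiv_map_of_apply_eq_one_iff {G M N : Type*} [Group G] [Group M] [Group N]
    (f : G →* M) (g : G →* N) (H : Subgroup G) (h : ∀ x ∈ H, f x = 1 ↔ g x = 1) :
    Nonempty (H.map f ≃* H.map g) := by
  have hker : (f.restrict H).ker = (g.restrict H).ker := by
    ext x
    rw [MonoidHom.mem_ker, MonoidHom.mem_ker, MonoidHom.restrict_apply, MonoidHom.restrict_apply]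
    exact h x x.2
  have e : (f.restrict H).range ≃* (g.restrict H).range :=
    (QuotientGroup.quotientKerEquivRange _).symm.trans
      ((QuotientGroup.quotientMulEquivOfEq hker).trans (QuotientGroup.quotientKerEquivRange _))
  exact ⟨(MulEquiv.subgroupCongr (MonoidHom.restrict_range (K := H) (f := f)).symm).trans
    (e.trans (MulEquiv.subgroupCongr (MonoidHom.restrict_range (K := H) (f := g))))⟩

end GL2

/-! ## §7 Transports: change of Weierstrass model, change of frame -/

section Transport

/-- **A framing of `E[n]` is a framing of `E'[n]` for an isomorphic equation `E' = C • E`** (the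
coordinate change `E(F̄) ≃ E'(F̄)` is `Γ_F`-equivariant,
`VariableChange.pointEquivBaseChange_map_algEquiv`); a copy of the tree's `isTorsionGaloisRep_smul`
(`MatarNekovar2019/IrreducibleOverQuadraticFieldClauseThreeProofs`), kept here to keep the imports
light (Silverman, *AEC* III.§7). [cite: SilvermanAEC2009, III.§7] -/
theorem isTorsionGaloisRep_variableChange {F : Type} [Field F] (X : WeierstrassCurve F)
    (C : VariableChange F) {n : ℕ} [Fact n.Prime] {ρ : ModPGaloisRep F (ZMod n) 2}
    (hρ : X.IsTorsionGaloisRep n ρ) : (C • X).IsTorsionGaloisRep n ρ := by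
  obtain ⟨e₀, he₀⟩ := hρ
  let e : geomPoints X ≃+ geomPoints (C • X) :=
    VariableChange.pointEquivBaseChange X C (AlgebraicClosure F)
  have hsmul : ∀ (σ : absoluteGaloisGroup F) (P : geomPoints X), e (σ • P) = σ • e P := fun σ P ↦
    VariableChange.pointEquivBaseChange_map_algEquiv X C (absoluteGaloisGroup.toAlgEquiv F σ) P
  have htor : ∀ {P : geomPoints X}, P ∈ geomTorsion X n ↔ e P ∈ geomTorsion (C • X) n := by
    intro P
    rw [geomTorsion, geomTorsion, AddSubgroup.torsionBy.nsmul_iff, AddSubgroup.torsionBy.nsmul_iff,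
      ← map_nsmul, AddEquiv.map_eq_zero_iff]
  let eₙ : geomTorsion X n ≃+ geomTorsion (C • X) n :=
    { toFun := fun P ↦ ⟨e P, htor.mp P.2⟩
      invFun := fun Q ↦ ⟨e.symm Q, by rw [htor, e.apply_symm_apply]; exact Q.2⟩
      left_inv := fun P ↦ Subtype.ext (e.symm_apply_apply _)
      right_inv := fun Q ↦ Subtype.ext (e.apply_symm_apply _)
      map_add' := fun P Q ↦ Subtype.ext (by
        change e ((P : geomPoints X) + Q) = e P + e Q
        exact map_add e _ _) }
  have heₙ : ∀ (σ : absoluteGaloisGroup F) (P : geomTorsion X n), eₙ (σ • P) = σ • eₙ P :=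
    fun σ P ↦ Subtype.ext (by
      change e ((σ • P : geomTorsion X n) : geomPoints X) = _
      rw [AddSubgroup.torsionBy.coe_smul, hsmul]
      rfl)
  have heₙ' : ∀ (σ : absoluteGaloisGroup F) (Q : geomTorsion (C • X) n),
      eₙ.symm (σ • Q) = σ • eₙ.symm Q := by
    intro σ Q
    apply eₙ.injective
    rw [heₙ, eₙ.apply_symm_apply, eₙ.apply_symm_apply]
  refine ⟨eₙ.symm.trans e₀, fun σ Q ↦ ?_⟩
  rw [AddEquiv.trans_apply, AddEquiv.trans_apply, heₙ', he₀]

/-- Comparing the `T`-coefficients of `1 - A T + B T² = 1 - A' T + B' T²`. [folklore] -/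
private theorem eq_of_one_sub_C_mul_X_add_eq' {A B A' B' : ℤ}
    (h : (1 - C A * X + C B * X ^ 2 : ℤ[X]) = 1 - C A' * X + C B' * X ^ 2) : A = A' := by
  have := congrArg (fun f : ℤ[X] => f.coeff 1) h
  simpa using this

/-- **`a_v` is a `K`-isomorphism invariant at a place of good reduction** (a copy of the tree's
`frobeniusTraceAt_smul`, `SolvableBaseChangeModularityProofs`, kept here to keep the imports
light: the local polynomial `1 - a_v T + q_v T²` is an isomorphism invariant,
`localPolynomial_smul`).  Silverman, *AEC*, VII.1 Prop. 1.3(b), C.§16.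
[cite: SilvermanAEC2009, VII.1 Prop. 1.3(b) and C.§16] -/
theorem frobeniusTraceAt_variableChange {K : Type*} [Field K] [NumberField K]
    (W : WeierstrassCurve K) [W.IsElliptic] (C : VariableChange K) (v : HeightOneSpectrum (𝓞 K))
    (hv : W.HasGoodReductionAt v) : (C • W).frobeniusTraceAt v = W.frobeniusTraceAt v := by
  have hv' : (C • W).HasGoodReductionAt v := (hasGoodReductionAt_smul_iff_holds v W C).2 hv
  have h1 := localPolynomialAt_of_hasGoodReductionAt hv
  have h2 := localPolynomialAt_of_hasGoodReductionAt hv'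
  have h3 : (C • W).localPolynomialAt v = W.localPolynomialAt v := by
    simp only [localPolynomialAt, baseChange, ← map_variableChange]
    exact localPolynomial_smul _ _ _
  rw [h3, h1] at h2
  exact (eq_of_one_sub_C_mul_X_add_eq' h2).symm

/-- The place of `ℚ` containing the prime `ℓ` is the place of `ℓ` (a copy of the tree's
`primesEquiv_eq_of_natCast_mem`, `TorsionFrobeniusProofs`). [folklore] -/
private theorem primesEquiv_eq_of_natCast_mem' {v : HeightOneSpectrum (𝓞 ℚ)} {ℓ : ℕ} (hℓ : ℓ.Prime)
    (hv : (ℓ : 𝓞 ℚ) ∈ v.asIdeal) : (primesEquiv v : ℕ) = ℓ := by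
  have h1 : natGenerator v ∣ ℓ := by
    rw [natGenerator_dvd_iff, Ideal.mem_map_of_equiv]
    exact ⟨ℓ, hv, map_natCast _ ℓ⟩
  exact (Nat.prime_dvd_prime_iff_eq (prime_natGenerator v) hℓ).mp h1

end Transport

/-! ## §8 The discharge of `serre1972_supersingular_decompositionSubgroup_image` -/

section Discharge

/-- A framing is faithful on `E[n]`: `ρ̄(σ) = 1` iff `σ` fixes `E[n]` pointwise (the frame is a
bijection; the tree's `IsTorsionGaloisRep.apply_eq_one_iff_forall_smul_eq`,
`GoodReductionPeuRamifieProofs`, re-proved to keep the imports light). Silverman, *AEC* III.§7.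
[cite: SilvermanAEC2009, III.§7] -/
theorem IsTorsionGaloisRep.apply_eq_one_iff_forall_smul_eq' {F : Type} [Field F]
    {W : WeierstrassCurve F} {n : ℕ} {ρ : FramedGaloisRep F (ZMod n) 2}
    (hρ : W.IsTorsionGaloisRep n ρ) (σ : absoluteGaloisGroup F) :
    ρ σ = 1 ↔ ∀ P : geomTorsion W n, σ • P = P := by
  refine ⟨fun h P ↦ ?_, fun h ↦ hρ.eq_one_of_forall_smul_eq h⟩
  obtain ⟨e, he⟩ := hρ
  apply e.injective
  rw [he σ P, h, Units.val_one, Matrix.one_mulVec]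

/-- **Serre 1972, §1.11 Prop. 12 (c), (d) over `ℚ` — discharge of the named fact
`serre1972_supersingular_decompositionSubgroup_image`.**  For `W/ℚ` elliptic, `p` prime, `v ∣ p`
a place of good reduction with `p ∣ a_v` (supersingular), any framing `ρ̄` of `E[p](ℚ̄)` and any
prime `𝔓 ∣ v` of `\bar ℤ`: `ρ̄(I_𝔓)` is cyclic of order `p² - 1` and `#ρ̄(D_𝔓) = 2(p² - 1)`.
Assembly: pass to a global minimal model (`hasGlobalMinimalModel_rat_holds`; the framing, good
reduction and `a_v` are `ℚ`-isomorphism invariants), to the prime cut out by `placeOver p`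
(conjugate to `𝔓`, `exists_smul_eq_of_mem_primesAbove_holds`), prove (c) there for the intrinsic
`ρ̄ = galoisRepTorsion` (`isCyclic_and_card_inertia_map_of_dvd_frobeniusTrace_all`, tame Kummer
input `exists_mem_inertia_smul_eq_mul_of_pow_eq`) and the Frobenius escape
(`exists_mem_decompositionSubgroup_forall_exists_smul_ne`), transport both to `𝔓` and to `ρ̄`
(same kernel), and conclude (d) in `GL₂(𝔽_p)` by §2.2
(`card_eq_two_mul_of_isCyclic_of_le_normalizer`).
[cite: SerreInventiones1972, §1.11 Prop. 12 (c),(d); §2.1 b); §2.2] -/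
theorem serre1972_supersingular_decompositionSubgroup_image_holds :
    serre1972_supersingular_decompositionSubgroup_image := by
  intro W _ p _ v hpv hgood htr ρ hρ 𝔓 h𝔓
  have hp : p.Prime := Fact.out
  -- a global minimal model `W' = C • W`
  obtain ⟨C, hmin⟩ := hasGlobalMinimalModel_rat_holds W
  haveI := hmin
  have hρ' : (C • W).IsTorsionGaloisRep p ρ := isTorsionGaloisRep_variableChange W C hρ
  have hgood' : (C • W).HasGoodReductionAt v := (hasGoodReductionAt_smul_iff_holds v W C).2 hgood
  have htr' : (p : ℤ) ∣ (C • W).frobeniusTraceAt v := by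
    rw [frobeniusTraceAt_variableChange W C v hgood]; exact htr
  have hv : (primesEquiv v : ℕ) = p := primesEquiv_eq_of_natCast_mem' hp hpv
  have hgp : (C • W).HasGoodReductionAtPrime p :=
    (hasGoodReductionAtPrime_primesEquiv_iff_holds (C • W) v p hv).mpr hgood'
  have hΔ : ¬ (p : ℤ) ∣ minimalDiscriminantInt (C • W) :=
    not_dvd_minimalDiscriminantInt_of_hasGoodReductionAtPrime' (C • W) p hgp
  have hss : (p : ℤ) ∣ (C • W).frobeniusTrace p := by
    have h1 := (C • W).lFunction_primesEquiv_eq_frobeniusTraceAt hgood'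
    rw [hv, LFunction_apply_prime_eq_frobeniusTrace (C • W) p hgp] at h1
    rw [h1]; exact htr'
  -- the place's prime `𝔓₀` and `g` with `g • 𝔓₀ = 𝔓`
  obtain ⟨𝔓₀, hmem, h𝔓₀⟩ := exists_ideal_placeOver p hv
  obtain ⟨g, hg⟩ :=
    HeightOneSpectrum.exists_smul_eq_of_mem_primesAbove_holds (K := ℚ) (v := v) h𝔓₀ h𝔓
  set ρ₀ := galoisRepTorsion (C • W) p with hρ₀
  set I := 𝔓.inertia (absoluteGaloisGroup ℚ) with hI
  set D := 𝔓.decompositionSubgroup (absoluteGaloisGroup ℚ) with hD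
  have hn : 0 < p ^ 2 - 1 := by
    have : 4 ≤ p ^ 2 := by nlinarith [hp.two_le]
    omega
  -- (c) for `ρ₀` at `𝔓₀`, then at `𝔓`
  have hc₀ := isCyclic_and_card_inertia_map_of_dvd_frobeniusTrace_all p hΔ hss hmem
    (fun π ζ hπ hζ ↦ exists_mem_inertia_smul_eq_mul_of_pow_eq p hn hv h𝔓₀ hπ hζ)
  have hc : IsCyclic (I.map ρ₀) ∧ Nat.card (I.map ρ₀) = p ^ 2 - 1 := by
    rw [hI, ← hg]
    exact isCyclic_and_card_map_inertia_smul ρ₀ g 𝔓₀ hc₀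
  -- the Frobenius escape at `𝔓₀`, then at `𝔓`
  obtain ⟨φ₀, hφ₀D, hφ₀⟩ :=
    exists_mem_decompositionSubgroup_forall_exists_smul_ne p hΔ hss hv hmem h𝔓₀
  have hesc : ∃ φ ∈ D, ∀ τ ∈ I, ∃ P : geomTorsion (C • W) p, τ • P ≠ φ • P := by
    refine ⟨g * φ₀ * g⁻¹, ?_, fun τ hτ ↦ ?_⟩
    · rw [hD, ← hg, Ideal.decompositionSubgroup_smul]
      change MulAut.conj g • φ₀ ∈ MulAut.conj g • 𝔓₀.decompositionSubgroup (absoluteGaloisGroup ℚ)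
      exact Subgroup.smul_mem_pointwise_smul _ _ _ hφ₀D
    · have hτ' : τ ∈ (g • 𝔓₀).inertia (absoluteGaloisGroup ℚ) := by rw [hg]; exact hτ
      obtain ⟨P, hP⟩ :=
        hφ₀ (g⁻¹ * τ * g) (DegreeOnePrimes.conj_mem_inertia_of_mem_inertia_smul hτ')
      refine ⟨g • P, fun heq ↦ hP ?_⟩
      apply MulAction.injective g
      change g • ((g⁻¹ * τ * g) • P) = g • (φ₀ • P)
      rw [← mul_smul, show g * (g⁻¹ * τ * g) = τ * g by group, mul_smul, heq, mul_smul, mul_smul,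
        inv_smul_smul]
  -- the framing `ρ̄` and the intrinsic `ρ₀` have the same kernel
  have hker : ∀ σ : absoluteGaloisGroup ℚ, ρ.toMonoidHom σ = 1 ↔ ρ₀ σ = 1 := by
    intro σ
    rw [hρ₀, galoisRepTorsion_eq_one_iff']
    exact IsTorsionGaloisRep.apply_eq_one_iff_forall_smul_eq' hρ' σ
  obtain ⟨e⟩ := nonempty_mulEquiv_map_of_apply_eq_one_iff ρ.toMonoidHom ρ₀ I (fun x _ ↦ hker x)
  have hcρ : IsCyclic (I.map ρ.toMonoidHom) ∧ Nat.card (I.map ρ.toMonoidHom) = p ^ 2 - 1 := by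
    haveI := hc.1
    exact ⟨isCyclic_of_surjective e.symm e.symm.surjective, by rw [Nat.card_congr e.toEquiv, hc.2]⟩
  refine ⟨hcρ.1, hcρ.2, ?_⟩
  -- the decomposition group: `C ≤ N ≤ N(C)`, `N ≠ C`
  have hCN : I.map ρ.toMonoidHom ≤ D.map ρ.toMonoidHom :=
    Subgroup.map_mono (Ideal.inertia_le_decompositionSubgroup _ _)
  have hNle : D.map ρ.toMonoidHom ≤
      Subgroup.normalizer (I.map ρ.toMonoidHom : Set (GL (Fin 2) (ZMod p))) :=
    (Subgroup.map_mono (decompositionSubgroup_le_normalizer_inertia 𝔓)).trans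
      (Subgroup.le_normalizer_map _)
  have hne : ¬ D.map ρ.toMonoidHom ≤ I.map ρ.toMonoidHom := by
    obtain ⟨φ, hφD, hφ⟩ := hesc
    intro hle
    obtain ⟨τ, hτ, hτφ⟩ := hle ⟨φ, hφD, rfl⟩
    obtain ⟨P, hP⟩ := hφ τ hτ
    apply hP
    have h1 : ρ.toMonoidHom (φ⁻¹ * τ) = 1 := by rw [map_mul, map_inv, hτφ, inv_mul_cancel]
    have h2 := (hker _).mp h1
    rw [hρ₀, galoisRepTorsion_eq_one_iff'] at h2
    have h3 := h2 P
    rw [mul_smul, inv_smul_eq_iff] at h3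
    exact h3
  exact card_eq_two_mul_of_isCyclic_of_le_normalizer hcρ.1 hcρ.2 hCN hNle hne

end Discharge

end Literature.NumberTheory.EllipticCurves

end
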